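import Mathlib
import Literature.NumberTheory.LFunctions.Zhang2022.SkeletonPartThree
import HarnessLib

/-!
# Zhang (2022), typed statements — §12 second part (pp. 68–71): Lemmas 12.1, 12.2, 12.3 and
# every displayed step of their proofs

Topic `Literature/NumberTheory/LFunctions/Zhang2022` (Landau–Siegel audit tree; verdict-neutral;
campaign D-0069, layer L3, file `TypedSection12B`, DAG nodes `Z22:Lem12.1 … Z22:§12.u034`,
tex L3476–L3590 of the arXiv source). Y. Zhang, *Discrete mean estimates and the Landau–Siegel
zero*, arXiv:2211.02515v1 (2022) [Zhang2022LandauSiegel] — **an unrefereed manuscript under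
adjudication; every `def … : Prop` below is a CLAIM OF THE MANUSCRIPT, STATED NOT ASSERTED**
(typed ≠ discharged), except the bookkeeping identities proved here (`lemma121_iff`,
`bstar_eq_display`, `P2pp_div_gt_T10_holds`) and the DISCHARGED proof steps `U022_holds` (u022),
`U031_holds` (u031, the "direct calculation" residue identity of p. 70), `circ025_eq` (the closed
form of the circle integral in u025, p. 69), `U033_holds` (u033, the derivative of p. 70),
`U027_holds` (u027, `−(log P)²∫₀^{0.004} z e^{3πiz/2}dz`), `U023_holds` and `U029_holds` (the two
"Hence … = −(1/log P₁)∂_w(…)|₀" identities), and the kernel-checked ASSEMBLY EDGE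
`eq1210L15_of_u026read : U026read c′ → Eq1210L15 c′` ("Gathering these results together we obtain
(12.10)": u023 + u026 + u027 + `b*` + `log P₁ = 0.504 log P` give (12.10) with `O(𝓛⁻¹⁵)`, the main
term exactly as printed). Nothing here asserts or denies Theorems 1–2.

The three lemmas themselves are ALREADY NODES of the banked skeleton and are only referenced:
`Skeleton.Lemma121 c′` (Lemma 12.1), `Skeleton.Lemma123 c′` (Lemma 12.3), with the objects
`Skeleton.P1pp`, `Skeleton.P2pp` (`P″₁ = P^{0.496}Dt₀`, `P″₂ = P^{0.5}Dt₀`), `Skeleton.vk13` (`ϰ₁₃`),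
`Skeleton.xiZero` (`ξ₀ⱼ(n;d,r)`, the reading of the printed `ξ_j(l;d,r)`), `Skeleton.PiW` (`Π(d,r)`),
`Skeleton.betaJ` (`β_j`, `β₄ = β₁`, `β₅ = β₂`), `Skeleton.gW` (`g`, (4.1)), `GaussWeight.omega1`
(`ω₁`), and the tree's `bstar` (`b*`, (12.10), `Section18Defs`). Lemma 12.2 was NOT a skeleton node
(it is internal to `Skeleton.Ded1217`); it is typed here (`Eq1210`, `Eq1211`, `Lemma122`).

| DAG node | locator | decl | printed claim / object |
|---|---|---|---|
| Z22:Lem12.1 | p.68, L3478 | `lemma121` (= `Skeleton.Lemma121 c′`) | Lemma 12.1 |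
| Z22:§12.u018 | p.68, L3479 | `U018` | `Σ_l χ(l)ϰ₁₃(dl)l^{β_j−1} ≪ T^{−c}` (`d ≤ P″₁/T`), `≪ α₁` (`P″₁/T < d ≤ P″₁`) |
| Z22:§12.u019 | p.68, L3486 | `U019` | `= (L′(1,χ)/log P₁)(−1 + (2β₆−β_j)log(d/P″₁) + ε₁ⱼ(d))`, `|ε₁ⱼ(d)| < 10⁻⁵` (`P″₁ < d < P₂`) |
| Z22:Lem12.1.pf | p.68, L3492 | `Rem121vk13`, `P2pp_div_gt_T10`, `Ded121` | "`ϰ₁₃(n) ≪ α₁` if `P″₁/T ≤ n ≤ P″₁T`"; "`P″₂/d > T¹⁰`"; Pólya–Vinogradov + partial summation + Lemma 5.8 ⇒ Lemma 12.1 |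
| Z22:§12.u020 | p.68, L3493 | `U020` | the two-line evaluation of the sum for `P″₁ < d < P₂` |
| Z22:Lem12.2 | p.69, L3502 | `Lemma122 E` | Lemma 12.2 = (12.10) ∧ (12.11) |
| Z22:(12.10) | p.69, L3503 | `Eq1210 E`, `Eq1210L15` (⇐ `U026read`: `eq1210L15_of_u026read`, proved) | `Σ_l χ(l)ϰ̄₁₃(drl)ξ_j(l;d,r)/l = b*L′(1,χ)Π(d,r)(log P)β_{j+1}β_{j+2} + O` [error term BLANK in print] |
| Z22:§12.u021 | p.69, L3507 | `bstar_eq_display` | `b* = (1/0.504)∫₀^{0.004} z e^{3πiz/2}dz` (= tree `bstar`, by `rfl`) |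
| Z22:(12.11) | p.69, L3511 | `Eq1211` | `Σ_l χ(l)ϰ̄₁₃(drl)ξ_j(l;d,r)/l ≪ α₁` (`P″₁/T ≤ dr ≤ P″₁`; printed "`n`") |
| Z22:Lem12.2.pf | p.69, L3518 | `Ded122 E` | Lemmas 8.2 [sic, 8.3], 8.4 (method), 5.8, "(4) and (4)" ⇒ Lemma 12.2 |
| Z22:§12.u022 | p.69, L3519 | `U022` | `ϰ̄₁₃(n) = −(1/log P₁)∂_w (n/P″₁)^{β₆−w}|_{w=0}` |
| Z22:§12.u023 | p.69, L3523 | `innerSum`, `bracket122`, `U023` | `Σ_l … = −(1/log P₁)∂_w((dr/P″₁)^{β₆−w}Σ_{P″₁/dr<l<P″₂/dr} χ(l)ξ_j/l^{1−β₆+w})|_{w=0}` |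
| Z22:§12.u024 | p.69, L3528 | `gSeries`, `lineInt024`, `U024` | `dr ≤ P″₁/T`, `|w| = α`: the `g`-weighted series and the Perron integral on `(1)`, each `+O(𝓛⁻¹⁵)` |
| Z22:§12.u025 | p.69, L3534 | `circ025`, `U025` | `= L′(1,χ)Π(d,r)(2πi)⁻¹∮_{|s|=5α}(…)((P″₂/dr)^s−(P″₁/dr)^s)ds/s + O(𝓛⁻¹⁵) = L′Πβ_{j+1}β_{j+2}[(P″₂/dr)^{β₆−w}−(P″₁/dr)^{β₆−w}]/(β₆−w) + O(𝓛⁻¹⁵)` |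
| Z22:§12.u026 | pp.69–70, L3541 | `U026`, `U026read` | Cauchy: `∂_w(bracket)|₀ = ∂_w(∫₁^{P^{0.004}}y^{β₆−w−1}dy)|₀ + O(𝓛⁻⁶)` (AS PRINTED: the factor `L′(1,χ)Π(d,r)β_{j+1}β_{j+2}` is absent) |
| Z22:§12.u027 | p.70, L3546 | `U027` | `∂_w(∫₁^{P^{0.004}}y^{β₆−w−1}dy)|₀ = −(log P)²∫₀^{0.004} z e^{3πiz/2}dz` |
| Z22:Lem12.3, Z22:§12.u028 | p.70, L3551–3552 | `lemma123` (= `Skeleton.Lemma123 c′`) | Lemma 12.3 |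
| Z22:Lem12.3.pf | p.70, L3558 | `Ded123` | "similar to the proof of Lemma 12.1 [sic]" + "direct calculation" ⇒ Lemma 12.3 |
| Z22:§12.u029 | p.70, L3559 | `innerSumLow`, `bracket123`, `U029` | "The left side is equal to `−(1/log P₁)∂_w((dr/P″₁)^{β₆−w}Σ_{l<P″₂/dr} …)|₀`" |
| Z22:§12.u030 | p.70, L3564 | `circ030`, `U030` | `|w| = α`: `Σ_{l<P″₂/dr} … = L′(1,χ)Π(d,r)(2πi)⁻¹∮_{|s|=5α}(…)(P″₂/dr)^s ds/s + O(𝓛⁻¹⁵)` |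
| Z22:§12.u031 | p.70, L3571 | `U031` | "By direct calculation" the circle integral `= w − β₆ + β_{j+1} + β_{j+2} + β_{j+1}β_{j+2}∫₁^{P″₂/dr} y^{β₆−w−1}dy` |
| Z22:§12.u032 | p.70, L3577 | `F032` | the function of `w` whose derivative at `0` is taken |
| Z22:§12.u033 | p.70, L3581 | `rhs033`, `U033` | its derivative at `w = 0` |
| Z22:§12.u034 | p.71, L3587 | `U034` | "can be written as `1 − (−2β₆+β_{j+1}+β_{j+2})log(dr/P″₁) − ε₂ⱼ(dr)`", `|ε₂ⱼ| < 10⁻⁵` (NUM) |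

Conventions (layer L3, plan/L3/ASSIGNMENTS.md §0): "`= main + O(𝓛⁻ᵏ)`" ⇒ `∃ C, ForAllLarge … ‖lhs −
main‖ ≤ C·(𝓛ᵏ)⁻¹`; "`≪ T^{−c}`" ⇒ `∃ c > 0, ∃ C, … ≤ C·T^{−c}`; the undefined symbol `α₁` of v1 is
read `α𝓛` as in `Skeleton.Lemma121`; `ξ_j(l;d,r)` is read as the `ξ₀ⱼ(l;d,r)` of §7 (the only `ξ`
defined), as in `Skeleton.Lemma123`; `ϰ̄₁₃` is the complex conjugate of `ϰ₁₃` (cf. `𝐚₂₅ = conj 𝐚₁₅`);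
`∂_w(…)|_{w=0}` is `deriv (fun w => …) 0`; `(2πi)⁻¹∫_{|s|=5α}` is `(2πI)⁻¹ ∮ s in C(0,5α)`;
`(2πi)⁻¹∫_{(1)} F(s)ds` is `(2π)⁻¹∫_ℝ F(1+it)dt`. Malformed references inside this span (LOCATORS.md):
"By (4) and (4)" (L3527; presumably (4.2)–(4.3), the tree's `GaussWeight.abs_gWeight_sub_one_le` /
`gWeight_le`), "The proof of (12.11) is similar to that of ." (L3549), and the blank error term of
(12.10) (L3504) — recorded in the docstrings, reported as GAP candidates on the cell's STATUS, never
repaired here. No new named facts: Pólya–Vinogradov, cited in the proof of Lemma 12.1, is a THEOREM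
of the tree (`polyaVinogradov`, `Literature/NumberTheory/Sieve/LargeSieveCharacters`; the campaign's
FACT-LIST row F-16 names `Literature.NumberTheory.LFunctions.norm_partialSum_le_polyaVinogradov`).

## References

* Y. Zhang, arXiv:2211.02515v1 (2022), §12 pp. 68–71, Lemmas 12.1–12.3, (12.10)–(12.11).
  [cite: Zhang2022LandauSiegel, §12 pp. 68–71]
-/

noncomputable section

open Complex Real ComplexConjugate

namespace Literature.NumberTheory.LFunctions.Zhang2022.Typed.Sec12B

open Literature.NumberTheory.LFunctions.Zhang2022.Skeleton

/-! ## Objects: the sums of Lemmas 12.1–12.3 and the expressions displayed in their proofs -/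

section Objects

variable (c' : ℝ) {D : ℕ} [NeZero D] (χ : DirichletCharacter ℂ D)

/-- The `l`-sum of **Lemma 12.1**: `Σ_l χ(l)ϰ₁₃(dl)/l^{1−β_j}` (finite: `ϰ₁₃(dl) = 0` unless
`P″₁ < dl < P″₂`; written over `1 ≤ l < ⌈P″₂⌉` exactly as inside the landed node `Skeleton.Lemma121`).
[cite: Zhang2022LandauSiegel, §12 Lemma 12.1, p. 68] [Z22 p.68, tex L3479] -/
def sum121 (j d : ℕ) : ℂ :=
  ∑ l ∈ Finset.Ico 1 ⌈P2pp D⌉₊, χ (l : ZMod D) * vk13 D (d * l) / (l : ℂ) ^ (1 - betaJ c' D j)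

/-- The `l`-sum of **Lemmas 12.2–12.3**: `Σ_l χ(l)ϰ̄₁₃(drl)ξ_j(l;d,r)/l` (`ϰ̄₁₃ = conj ϰ₁₃`;
`ξ_j(l;d,r)` read as `ξ₀ⱼ(l;d,r)` = `Skeleton.xiZero`; range as inside the landed `Skeleton.Lemma123`).
[cite: Zhang2022LandauSiegel, §12 Lemma 12.2, p. 69] [Z22 p.69, (12.10), tex L3503] -/
def sum122 (j d r : ℕ) : ℂ :=
  ∑ l ∈ Finset.Ico 1 ⌈P2pp D⌉₊,
    χ (l : ZMod D) * conj (vk13 D (d * r * l)) * xiZero c' D j l d r / (l : ℂ)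

/-- The first line of the display in the proof of Lemma 12.1 (case `P″₁ < d < P₂`), without its
`O(T^{−c})`: `((d/P″₁)^{−β₆}log(d/P″₁)/log P₁)·Σ_{l<P″₂/d} χ(l)/l^{1+β₆−β_j}
+ ((d/P″₁)^{−β₆}/log P₁)·Σ_{l<P″₂/d} χ(l)log l/l^{1+β₆−β_j}`.
[cite: Zhang2022LandauSiegel, §12 proof of Lemma 12.1, p. 68] [Z22 p.68, tex L3493] -/
def line020 (j d : ℕ) : ℂ :=
  ((d / P1pp D : ℝ) : ℂ) ^ (-beta6 D) * (Real.log (d / P1pp D) : ℂ) /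
        (Real.log (Skeleton.P1 D) : ℂ) *
      ∑ l ∈ Finset.Ico 1 ⌈P2pp D / d⌉₊, χ (l : ZMod D) / (l : ℂ) ^ (1 + beta6 D - betaJ c' D j) +
    ((d / P1pp D : ℝ) : ℂ) ^ (-beta6 D) / (Real.log (Skeleton.P1 D) : ℂ) *
      ∑ l ∈ Finset.Ico 1 ⌈P2pp D / d⌉₊,
        χ (l : ZMod D) * (Real.log l : ℂ) / (l : ℂ) ^ (1 + beta6 D - betaJ c' D j)

/-- The main term of **(12.10)**: `b*L′(1,χ)Π(d,r)(log P)β_{j+1}β_{j+2}` (`b*` = the tree's `bstar`).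
[cite: Zhang2022LandauSiegel, §12 (12.10), p. 69] [Z22 p.69, (12.10), tex L3503] -/
def main1210 (j d r : ℕ) : ℂ :=
  bstar * deriv χ.LFunction 1 * PiW χ d r * (Real.log (bigP D) : ℂ) *
    betaJ c' D (j + 1) * betaJ c' D (j + 2)

/-- The inner sum of the proof of Lemma 12.2: `Σ_{P″₁/dr<l<P″₂/dr} χ(l)ξ_j(l;d,r)/l^{1−β₆+w}`, as a
function of `w`. [cite: Zhang2022LandauSiegel, §12 proof of Lemma 12.2, p. 69] [Z22 p.69, tex L3523] -/
def innerSum (j d r : ℕ) (w : ℂ) : ℂ :=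
  ∑ l ∈ (Finset.Ico 1 ⌈P2pp D⌉₊).filter
      (fun l : ℕ => P1pp D / ((d * r : ℕ) : ℝ) < l ∧ (l : ℝ) < P2pp D / ((d * r : ℕ) : ℝ)),
    χ (l : ZMod D) * xiZero c' D j l d r / (l : ℂ) ^ (1 - beta6 D + w)

/-- The bracket differentiated in the proof of Lemma 12.2:
`(dr/P″₁)^{β₆−w}·Σ_{P″₁/dr<l<P″₂/dr} χ(l)ξ_j(l;d,r)/l^{1−β₆+w}`.
[cite: Zhang2022LandauSiegel, §12 proof of Lemma 12.2, p. 69] [Z22 p.69, tex L3523] -/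
def bracket122 (j d r : ℕ) (w : ℂ) : ℂ :=
  ((((d * r : ℕ) : ℝ) / P1pp D : ℝ) : ℂ) ^ (beta6 D - w) * innerSum c' χ j d r w

/-- The `g`-weighted series of the proof of Lemma 12.2 (`g` of (4.1) = `Skeleton.gW`):
`Σ_l χ(l)ξ_j(l;d,r)/l^{1−β₆+w}·{g(P″₂/(drl)) − g(P″₁/(drl))}` (absolutely convergent: `g` decays
like `exp(−𝓛³⁰log²)`, (4.3)). [cite: Zhang2022LandauSiegel, §12 proof of Lemma 12.2, p. 69]
[Z22 p.69, tex L3528] -/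
def gSeries (j d r : ℕ) (w : ℂ) : ℂ :=
  ∑' l : ℕ, χ (l : ZMod D) * xiZero c' D j l d r / (l : ℂ) ^ (1 - beta6 D + w) *
    ((gW D (P2pp D / ((d * r * l : ℕ) : ℝ)) - gW D (P1pp D / ((d * r * l : ℕ) : ℝ)) : ℝ) : ℂ)

/-- The Perron-type integral of the proof of Lemma 12.2:
`(2πi)⁻¹∫_{(1)} (Σ_l χ(l)ξ_j(l;d,r)/l^{1−β₆+w+s})((P″₂/dr)^s − (P″₁/dr)^s)ω₁(s)ds/s`, the series being
`Skeleton.xiSeries` at `1 − β₆ + w + s`, `ω₁(s) = exp{s²/(4𝓛³⁰)}` (`GaussWeight.omega1`), the line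
`Re s = 1` parametrised `s = 1 + it`. [cite: Zhang2022LandauSiegel, §12 proof of Lemma 12.2, p. 69]
[Z22 p.69, tex L3528] -/
def lineInt024 (j d r : ℕ) (w : ℂ) : ℂ :=
  ((1 / (2 * π) : ℝ) : ℂ) * ∫ t : ℝ,
    xiSeries c' χ j d r (1 - beta6 D + w + (1 + t * I)) *
      (((P2pp D / ((d * r : ℕ) : ℝ) : ℝ) : ℂ) ^ ((1 : ℂ) + t * I) -
        ((P1pp D / ((d * r : ℕ) : ℝ) : ℝ) : ℂ) ^ ((1 : ℂ) + t * I)) *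
      GaussWeight.omega1 (ell D ^ 30) (1 + t * I) / (1 + t * I)

omit [NeZero D] in
/-- The circle integral of the proof of Lemma 12.2 (display after "similar to the proof of Lemma 8.4"):
`(2πi)⁻¹∫_{|s|=5α} (s+w−β₆+β_{j+1})(s+w−β₆+β_{j+2})/(s+w−β₆) · ((P″₂/dr)^s − (P″₁/dr)^s)/s ds`.
[cite: Zhang2022LandauSiegel, §12 proof of Lemma 12.2, p. 69] [Z22 p.69, tex L3534] -/
def circ025 (D : ℕ) (j d r : ℕ) (w : ℂ) : ℂ :=
  (2 * π * I)⁻¹ * ∮ s in C(0, 5 * alpha D),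
    (s + w - beta6 D + betaJ c' D (j + 1)) * (s + w - beta6 D + betaJ c' D (j + 2)) /
        (s + w - beta6 D) *
      ((((P2pp D / ((d * r : ℕ) : ℝ) : ℝ) : ℂ) ^ s -
          ((P1pp D / ((d * r : ℕ) : ℝ) : ℝ) : ℂ) ^ s) / s)

omit [NeZero D] in
/-- The model integral of the Cauchy step: `∫₁^{P^{0.004}} y^{β₆−w−1}dy` as a function of `w`
(`P″₂/P″₁ = P^{0.004}`). [cite: Zhang2022LandauSiegel, §12 proof of Lemma 12.2, pp. 69–70]
[Z22 p.69, tex L3541] -/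
def modelInt026 (D : ℕ) (w : ℂ) : ℂ :=
  ∫ y in (1 : ℝ)..(bigP D ^ (0.004 : ℝ)), (y : ℂ) ^ (beta6 D - w - 1)

/-- The inner sum of the proof of Lemma 12.3 (`dr > P″₁`, so the lower constraint disappears):
`Σ_{l<P″₂/dr} χ(l)ξ_j(l;d,r)/l^{1−β₆+w}`. [cite: Zhang2022LandauSiegel, §12 proof of Lemma 12.3, p. 70]
[Z22 p.70, tex L3559] -/
def innerSumLow (j d r : ℕ) (w : ℂ) : ℂ :=
  ∑ l ∈ Finset.Ico 1 ⌈P2pp D / ((d * r : ℕ) : ℝ)⌉₊,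
    χ (l : ZMod D) * xiZero c' D j l d r / (l : ℂ) ^ (1 - beta6 D + w)

/-- The bracket differentiated in the proof of Lemma 12.3:
`(dr/P″₁)^{β₆−w}·Σ_{l<P″₂/dr} χ(l)ξ_j(l;d,r)/l^{1−β₆+w}`.
[cite: Zhang2022LandauSiegel, §12 proof of Lemma 12.3, p. 70] [Z22 p.70, tex L3559] -/
def bracket123 (j d r : ℕ) (w : ℂ) : ℂ :=
  ((((d * r : ℕ) : ℝ) / P1pp D : ℝ) : ℂ) ^ (beta6 D - w) * innerSumLow c' χ j d r w

omit [NeZero D] in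
/-- The circle integral of the proof of Lemma 12.3:
`(2πi)⁻¹∫_{|s|=5α} (s+w−β₆+β_{j+1})(s+w−β₆+β_{j+2})/(s+w−β₆) · (P″₂/dr)^s/s ds`.
[cite: Zhang2022LandauSiegel, §12 proof of Lemma 12.3, p. 70] [Z22 p.70, tex L3564] -/
def circ030 (D : ℕ) (j d r : ℕ) (w : ℂ) : ℂ :=
  (2 * π * I)⁻¹ * ∮ s in C(0, 5 * alpha D),
    (s + w - beta6 D + betaJ c' D (j + 1)) * (s + w - beta6 D + betaJ c' D (j + 2)) /
        (s + w - beta6 D) *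
      (((P2pp D / ((d * r : ℕ) : ℝ) : ℝ) : ℂ) ^ s / s)

omit [NeZero D] in
/-- **Z22:§12.u032** — the function of `w` displayed in the proof of Lemma 12.3:
`(dr/P″₁)^{β₆−w}(w − β₆ + β_{j+1} + β_{j+2} + β_{j+1}β_{j+2}∫₁^{P″₂/dr} y^{β₆−w−1}dy)`.
[cite: Zhang2022LandauSiegel, §12 proof of Lemma 12.3, p. 70] [Z22 p.70, tex L3577] -/
def F032 (D : ℕ) (j d r : ℕ) (w : ℂ) : ℂ :=
  ((((d * r : ℕ) : ℝ) / P1pp D : ℝ) : ℂ) ^ (beta6 D - w) *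
    (w - beta6 D + betaJ c' D (j + 1) + betaJ c' D (j + 2) +
      betaJ c' D (j + 1) * betaJ c' D (j + 2) *
        ∫ y in (1 : ℝ)..(P2pp D / ((d * r : ℕ) : ℝ)), (y : ℂ) ^ (beta6 D - w - 1))

omit [NeZero D] in
/-- **Z22:§12.u033** (right side) — the displayed value of the derivative of `F032` at `w = 0`:
`(dr/P″₁)^{β₆}(1 − β_{j+1}β_{j+2}∫₁^{P″₂/dr} y^{β₆−1}log y dy)
− (dr/P″₁)^{β₆}log(dr/P″₁)(−β₆ + β_{j+1} + β_{j+2} + β_{j+1}β_{j+2}∫₁^{P″₂/dr} y^{β₆−1}dy)`.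
[cite: Zhang2022LandauSiegel, §12 proof of Lemma 12.3, p. 70] [Z22 p.70, tex L3581] -/
def rhs033 (D : ℕ) (j d r : ℕ) : ℂ :=
  ((((d * r : ℕ) : ℝ) / P1pp D : ℝ) : ℂ) ^ beta6 D *
      (1 - betaJ c' D (j + 1) * betaJ c' D (j + 2) *
        ∫ y in (1 : ℝ)..(P2pp D / ((d * r : ℕ) : ℝ)), (y : ℂ) ^ (beta6 D - 1) * (Real.log y : ℂ)) -
    ((((d * r : ℕ) : ℝ) / P1pp D : ℝ) : ℂ) ^ beta6 D *
      (Real.log (((d * r : ℕ) : ℝ) / P1pp D) : ℂ) *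
      (-beta6 D + betaJ c' D (j + 1) + betaJ c' D (j + 2) +
        betaJ c' D (j + 1) * betaJ c' D (j + 2) *
          ∫ y in (1 : ℝ)..(P2pp D / ((d * r : ℕ) : ℝ)), (y : ℂ) ^ (beta6 D - 1))

end Objects

/-! ## Lemma 12.1 and its proof (p. 68) -/

section LemmaTwelveOne

variable (c' : ℝ)

/-- **Z22:Lem12.1 — Lemma 12.1** is the landed skeleton node `Skeleton.Lemma121 c′` (p409865; AS
PRINTED, `|ε₁ⱼ(d)| < 10⁻⁵`); referenced, not re-typed. Its two displays are `U018`, `U019`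
(`lemma121_iff`). [cite: Zhang2022LandauSiegel, §12 Lemma 12.1, p. 68] [Z22 p.68, tex L3478] -/
abbrev lemma121 : Prop := Skeleton.Lemma121 c'

/-- **Z22:§12.u018** — the first display of Lemma 12.1 (`1 ≤ j ≤ 3`): "`Σ_l χ(l)ϰ₁₃(dl)/l^{1−β_j} ≪
T^{−c}` if `d ≤ P″₁/T`, `≪ α₁` if `P″₁/T < d ≤ P″₁`" (`α₁`, undefined in v1, read `α𝓛` as in the
landed node). CLAIM. [cite: Zhang2022LandauSiegel, §12 Lemma 12.1, p. 68] [Z22 p.68, tex L3479] -/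
def U018 : Prop :=
  ∃ c : ℝ, 0 < c ∧ ∃ C : ℝ, ForAllLarge fun D _ χ => AssumptionA D χ →
    ∀ j ∈ ({1, 2, 3} : Finset ℕ), ∀ d : ℕ, 1 ≤ d →
      ((d : ℝ) ≤ P1pp D / bigT D → ‖sum121 c' χ j d‖ ≤ C * bigT D ^ (-c)) ∧
      (P1pp D / bigT D < d → (d : ℝ) ≤ P1pp D → ‖sum121 c' χ j d‖ ≤ C * alpha D * ell D)

/-- **Z22:§12.u019** — the second display of Lemma 12.1: "`Σ_l χ(l)ϰ₁₃(dl)/l^{1−β_j} =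
(L′(1,χ)/log P₁)(−1 + (2β₆ − β_j)log(d/P″₁) + ε₁ⱼ(d))`, `|ε₁ⱼ(d)| < 10⁻⁵`, if `P″₁ < d < P₂`"
(the rounding symbol kept as a BOUND: `‖Σ − (L′/log P₁)(−1 + (2β₆−β_j)log(d/P″₁))‖ ≤
10⁻⁵|L′(1,χ)|/log P₁`, exactly as in the landed node). CLAIM; NUM:pending (read1 PRIOR: pointwise
bound contested). [cite: Zhang2022LandauSiegel, §12 Lemma 12.1, p. 68] [Z22 p.68, tex L3486] -/
def U019 : Prop :=
  ForAllLarge fun D _ χ => AssumptionA D χ →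
    ∀ j ∈ ({1, 2, 3} : Finset ℕ), ∀ d : ℕ, 1 ≤ d → P1pp D < d → (d : ℝ) < Skeleton.P2 D →
      ‖sum121 c' χ j d - deriv χ.LFunction 1 / Real.log (Skeleton.P1 D) *
          (-1 + (2 * beta6 D - betaJ c' D j) * (Real.log (d / P1pp D) : ℂ))‖ ≤
        1e-5 * ‖deriv χ.LFunction 1‖ / Real.log (Skeleton.P1 D)

/-- The landed node `Skeleton.Lemma121 c′` is exactly the conjunction of its two displays as typed
here (bookkeeping; kernel-checked). [cite: Zhang2022LandauSiegel, §12 Lemma 12.1, p. 68] -/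
theorem lemma121_iff : Skeleton.Lemma121 c' ↔ U018 c' ∧ U019 c' := by
  constructor
  · rintro ⟨c, hc, C, D₀, h⟩
    refine ⟨⟨c, hc, C, D₀, fun D _ χ hD hq hp hA j hj d hd => ?_⟩,
      ⟨D₀, fun D _ χ hD hq hp hA j hj d hd h1 h2 => ?_⟩⟩
    · have key := h D χ hD hq hp hA j hj d hd
      exact ⟨key.1, key.2.1⟩
    · have key := h D χ hD hq hp hA j hj d hd
      exact key.2.2 h1 h2
  · rintro ⟨⟨c, hc, C, D₁, h₁⟩, ⟨D₂, h₂⟩⟩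
    refine ⟨c, hc, C, max D₁ D₂, fun D _ χ hD hq hp hA j hj d hd => ?_⟩
    have k₁ := h₁ D χ (le_trans (le_max_left _ _) hD) hq hp hA j hj d hd
    have k₂ := h₂ D χ (le_trans (le_max_right _ _) hD) hq hp hA j hj d hd
    exact ⟨k₁.1, k₁.2, k₂⟩

/-- **Z22:Lem12.1.pf, opening remark** — "Note that `ϰ₁₃(n) ≪ α₁` if `P″₁/T ≤ n ≤ P″₁T`" (with
the reading `α₁ = α𝓛` of the landed node; for the record: on that range `|ϰ₁₃(n)| ≤ log T/log P₁ =
𝓛^{1.1}/(0.504𝓛⁹)` exactly, and `α𝓛 = π𝓛⁻⁸` — the two differ by a factor `𝓛^{0.1}`; noted for the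
constants-flow audit, not adjudicated here). CLAIM. [cite: Zhang2022LandauSiegel, §12 proof of
Lemma 12.1, p. 68] [Z22 p.68, tex L3492] -/
def Rem121vk13 : Prop :=
  ∃ C : ℝ, ForAllLarge fun D _ _ => ∀ n : ℕ,
    P1pp D / bigT D ≤ n → (n : ℝ) ≤ P1pp D * bigT D → ‖vk13 D n‖ ≤ C * alpha D * ell D

/-- **Z22:Lem12.1.pf, closing remark** — "Since `P″₂/d > T¹⁰` …" for `d < P₂` (indeed `P″₂/P₂ =
Dt₀T¹⁰`). Stated for `1 ≤ d < P₂`; PROVED below (`P2pp_div_gt_T10_holds`).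
[cite: Zhang2022LandauSiegel, §12 proof of Lemma 12.1, p. 68] [Z22 p.68, tex L3498] -/
def P2pp_div_gt_T10 : Prop :=
  ForAllLarge fun D _ _ => ∀ d : ℕ, 1 ≤ d → (d : ℝ) < Skeleton.P2 D → bigT D ^ 10 < P2pp D / d

/-- `P″₂/d > T¹⁰` for `1 ≤ d < P₂` holds (for `D ≥ 3`: `P″₂ = P₂·T¹⁰·Dt₀` and `Dt₀ ≥ 1`).
[cite: Zhang2022LandauSiegel, §12 proof of Lemma 12.1, p. 68] -/
theorem P2pp_div_gt_T10_holds : P2pp_div_gt_T10 := by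
  refine ⟨3, fun D _ χ hD _ _ d hd hdP2 => ?_⟩
  have hD1 : (1 : ℝ) ≤ D := by exact_mod_cast le_trans (by norm_num) hD
  have hD3 : (3 : ℝ) ≤ D := by exact_mod_cast hD
  have hT : 0 < bigT D := Real.exp_pos _
  have hT10 : 0 < bigT D ^ 10 := pow_pos hT 10
  have hd0 : (0 : ℝ) < d := by exact_mod_cast hd
  have hlog : 1 ≤ ell D := by
    rw [ell]
    have h : Real.exp 1 ≤ (D : ℝ) := le_trans (le_of_lt Real.exp_one_lt_d9) (by linarith)
    exact (Real.le_log_iff_exp_le (by linarith)).mpr h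
  have ht0 : 1 ≤ t0 D := by rw [t0]; exact one_le_pow₀ hlog
  have hP2 : Skeleton.P2 D = bigP D ^ (0.5 : ℝ) / bigT D ^ 10 := rfl
  have hP2pp : P2pp D = bigP D ^ (0.5 : ℝ) * D * t0 D := rfl
  -- `d < P₂` gives `d·T¹⁰ < P^{1/2} ≤ P^{1/2}·D·t₀ = P″₂`
  have h1 : (d : ℝ) * bigT D ^ 10 < bigP D ^ (0.5 : ℝ) := by
    rw [hP2, lt_div_iff₀ hT10] at hdP2; exact hdP2
  have hPhalf : 0 < bigP D ^ (0.5 : ℝ) := Real.rpow_pos_of_pos (Real.exp_pos _) _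
  have h2 : bigP D ^ (0.5 : ℝ) ≤ P2pp D := by
    rw [hP2pp]
    have : bigP D ^ (0.5 : ℝ) * 1 * 1 ≤ bigP D ^ (0.5 : ℝ) * D * t0 D := by gcongr
    simpa using this
  rw [lt_div_iff₀ hd0]
  calc bigT D ^ 10 * d = d * bigT D ^ 10 := by ring
    _ < bigP D ^ (0.5 : ℝ) := h1
    _ ≤ P2pp D := h2

/-- **Z22:Lem12.1.pf — the proof of Lemma 12.1 as ONE named implication**: "In the case `d ≤ P″₁` the
results follow by the Polya-Vinogradov inequality and partial summation. … the result follows by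
Lemma 5.8 and a simple estimates." Inputs: Lemma 5.8 (node `Skeleton.Lemma58`, a THEOREM of the tree,
`lemma58_holds`) and the Pólya–Vinogradov inequality — FACT-LIST row **F-16**, a THEOREM of the
tree (`Literature.NumberTheory.LFunctions.norm_partialSum_le_polyaVinogradov`; also `polyaVinogradov`
in `Literature/NumberTheory/Sieve/LargeSieveCharacters`), hence not a hypothesis — so the deduction is
typed as `Lemma58 → Lemma121 c′`. CLAIM (deduction node).
[cite: Zhang2022LandauSiegel, §12 proof of Lemma 12.1, p. 68] [Z22 p.68, tex L3492] -/
def Ded121 : Prop := Lemma58 → Skeleton.Lemma121 c'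

/-- **Z22:§12.u020** — the displayed evaluation in the case `P″₁ < d < P₂`: "the sum becomes
`((d/P″₁)^{−β₆}log(d/P″₁)/log P₁)Σ_{l<P″₂/d} χ(l)/l^{1+β₆−β_j} + ((d/P″₁)^{−β₆}/log P₁)Σ_{l<P″₂/d}
χ(l)log l/l^{1+β₆−β_j} + O(T^{−c}) = (L′(1,χ)(d/P″₁)^{−β₆}/log P₁)(−1 + (β₆ − β_j)log(d/P″₁)) +
O(𝓛⁻¹⁵)`" — typed as the two approximations (sum vs. first line: `≤ C·T^{−c}`; first line vs. closed
form: `≤ C·𝓛⁻¹⁵`). CLAIM. [cite: Zhang2022LandauSiegel, §12 proof of Lemma 12.1, p. 68]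
[Z22 p.68, tex L3493] -/
def U020 : Prop :=
  ∃ c : ℝ, 0 < c ∧ ∃ C : ℝ, ForAllLarge fun D _ χ => AssumptionA D χ →
    ∀ j ∈ ({1, 2, 3} : Finset ℕ), ∀ d : ℕ, 1 ≤ d → P1pp D < d → (d : ℝ) < Skeleton.P2 D →
      ‖sum121 c' χ j d - line020 c' χ j d‖ ≤ C * bigT D ^ (-c) ∧
      ‖line020 c' χ j d -
          deriv χ.LFunction 1 * ((d / P1pp D : ℝ) : ℂ) ^ (-beta6 D) /
              (Real.log (Skeleton.P1 D) : ℂ) *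
            (-1 + (beta6 D - betaJ c' D j) * (Real.log (d / P1pp D) : ℂ))‖ ≤
        C * (ell D ^ 15)⁻¹

end LemmaTwelveOne

/-! ## Lemma 12.2, (12.10), (12.11) and the proof of Lemma 12.2 (pp. 69–70) -/

section LemmaTwelveTwo

variable (c' : ℝ)

/-- **Z22:(12.10)** — "If `dr < P″₁/T`, then `Σ_l χ(l)ϰ̄₁₃(drl)ξ_j(l;d,r)/l =
b*L′(1,χ)Π(d,r)(log P)β_{j+1}β_{j+2} + O`" — THE ERROR TERM IS BLANK IN PRINT (tex L3504: `+O\eqno`).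
Typed with the error rate as an explicit, externally quantified parameter `E : ℕ → ℝ` (a function of
`D`); `Eq1210L15` is the instance `E = 𝓛⁻¹⁵` that the printed proof chain supports (the `O(𝓛⁻¹⁵)` on
`|w| = α` of p. 69, Cauchy's formula `⇒ O(𝓛⁻⁶)` for the `w`-derivative (p. 70), times the prefactor
`1/log P₁ = 1/(0.504𝓛⁹)`). GAP candidate G·12d. CLAIM.
[cite: Zhang2022LandauSiegel, §12 Lemma 12.2 (12.10), p. 69] [Z22 p.69, (12.10), tex L3503] -/
def Eq1210 (E : ℕ → ℝ) : Prop :=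
  ∃ C : ℝ, ForAllLarge fun D _ χ => AssumptionA D χ →
    ∀ j ∈ ({1, 2, 3} : Finset ℕ), ∀ d r : ℕ, 1 ≤ d → 1 ≤ r →
      ((d * r : ℕ) : ℝ) < P1pp D / bigT D →
        ‖sum122 c' χ j d r - main1210 c' χ j d r‖ ≤ C * E D

/-- **(12.10) with the error rate `O(𝓛⁻¹⁵)`** — the reading the proof's last paragraph supports (see
`Eq1210`). CLAIM. [cite: Zhang2022LandauSiegel, §12 Lemma 12.2 (12.10), pp. 69–70]
[Z22 p.69, (12.10), tex L3503] -/
def Eq1210L15 : Prop := Eq1210 c' fun D => (ell D ^ 15)⁻¹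

/-- **Z22:§12.u021** — "`b* = (1/0.504)∫₀^{0.004} z e^{3πiz/2} dz`" IS the tree's `bstar`
(`Section18Defs`, certified in `Section18Certificate.bstar_eq`); recorded by `rfl`, not re-declared.
[cite: Zhang2022LandauSiegel, §12 (12.10), p. 69] [Z22 p.69, tex L3507] -/
theorem bstar_eq_display :
    bstar = ((1 / 0.504 : ℝ) : ℂ) * ∫ z in (0 : ℝ)..0.004, (z : ℂ) * cexp (3 * π * I * z / 2) := rfl

/-- **Z22:(12.11)** — "If `P″₁/T ≤ n ≤ P″₁` [sic: the variable is `dr`], then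
`Σ_l χ(l)ϰ̄₁₃(drl)ξ_j(l;d,r)/l ≪ α₁`" (`α₁` read `α𝓛`). Its printed proof is the sentence "The proof of
(12.11) is similar to that of ." (tex L3549, reference blank) — GAP candidate G·12e. CLAIM.
[cite: Zhang2022LandauSiegel, §12 Lemma 12.2 (12.11), p. 69] [Z22 p.69, (12.11), tex L3511] -/
def Eq1211 : Prop :=
  ∃ C : ℝ, ForAllLarge fun D _ χ => AssumptionA D χ →
    ∀ j ∈ ({1, 2, 3} : Finset ℕ), ∀ d r : ℕ, 1 ≤ d → 1 ≤ r →
      P1pp D / bigT D ≤ ((d * r : ℕ) : ℝ) → ((d * r : ℕ) : ℝ) ≤ P1pp D →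
        ‖sum122 c' χ j d r‖ ≤ C * alpha D * ell D

/-- **Z22:Lem12.2 — Lemma 12.2** = (12.10) ∧ (12.11), with the error rate `E` of (12.10) a parameter
(blank in print). Not a node of the banked skeleton (there it is internal to `Skeleton.Ded1217`).
CLAIM. [cite: Zhang2022LandauSiegel, §12 Lemma 12.2, p. 69] [Z22 p.69, tex L3502] -/
def Lemma122 (E : ℕ → ℝ) : Prop := Eq1210 c' E ∧ Eq1211 c'

/-- **Z22:Lem12.2.pf — the proof of Lemma 12.2 as ONE named implication.** Printed inputs: "By (4) and
(4)" [malformed; (4.2)–(4.3) for `g`, theorems of the tree], "In a way similar to the proof of Lemma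
8.4, by lemma 8.2 [sic; Lemma 8.3 is the statement about `Σχ(n)ξ₀ⱼ(n;d,r)n^{−s}`] and 5.8", "Cauchy'
integral formula", and for (12.11) "similar to that of ." [blank]. Typed with the §8 lemmas 8.2–8.4 and
Lemma 5.8 as hypotheses (8.2 and 5.8 are theorems of the tree: `lemma82_holds`, `lemma58_holds`).
CLAIM (deduction node). [cite: Zhang2022LandauSiegel, §12 proof of Lemma 12.2, pp. 69–70]
[Z22 p.69, tex L3518] -/
def Ded122 (E : ℕ → ℝ) : Prop :=
  Lemma82 c' → Lemma83 c' → Lemma84 c' → Lemma58 → Lemma122 c' E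

/-- **Z22:§12.u022** — "If `P″₁ < n < P″₂`, then `ϰ̄₁₃(n) = −(1/log P₁)·∂_w (n/P″₁)^{β₆−w}|_{w=0}`"
(`ϰ̄₁₃ = conj ϰ₁₃`; `β₆ = 3iα/2` is purely imaginary, so `conj((n/P″₁)^{−β₆}) = (n/P″₁)^{β₆}`). An exact
identity. CLAIM. [cite: Zhang2022LandauSiegel, §12 proof of Lemma 12.2, p. 69] [Z22 p.69, tex L3519] -/
def U022 : Prop :=
  ForAllLarge fun D _ _ => ∀ n : ℕ, P1pp D < n → (n : ℝ) < P2pp D →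
    conj (vk13 D n) =
      -(1 / (Real.log (Skeleton.P1 D) : ℂ)) *
        deriv (fun w : ℂ => ((n / P1pp D : ℝ) : ℂ) ^ (beta6 D - w)) 0

/-- `P″₁ = P^{0.496}Dt₀ > 0` for `D ≥ 3` (`P^{0.496} > 0`, `D > 0`, `t₀ = 𝓛⁵¹⁹ > 0`).
[cite: Zhang2022LandauSiegel, §12 p. 67] -/
theorem P1pp_pos {D : ℕ} (hD : 3 ≤ D) : 0 < P1pp D := by
  have hD' : (3 : ℝ) ≤ D := by exact_mod_cast hD
  have hlog : 0 < ell D := by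
    rw [ell]; exact Real.log_pos (by linarith)
  have ht0 : 0 < t0 D := by rw [t0]; exact pow_pos hlog _
  have hP : 0 < bigP D ^ (0.496 : ℝ) := Real.rpow_pos_of_pos (Real.exp_pos _) _
  rw [P1pp]
  positivity

/-- `β₆ = 3iα/2` is purely imaginary: `conj β₆ = −β₆`. [cite: Zhang2022LandauSiegel, §2 (2.22)] -/
theorem conj_beta6 (D : ℕ) : conj (beta6 D) = -beta6 D := by
  simp only [beta6, map_div₀, map_mul, map_ofNat, Complex.conj_I, Complex.conj_ofReal]
  ring

/-- **Z22:§12.u022 holds**: `ϰ̄₁₃(n) = −(1/log P₁)∂_w(n/P″₁)^{β₆−w}|_{w=0}` for `P″₁ < n < P″₂`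
(`∂_w x^{β₆−w} = −x^{β₆−w}log x`, and `conj(x^{−β₆}) = x^{β₆}` for real `x > 0`). Kernel-checked;
the node is DISCHARGED. [cite: Zhang2022LandauSiegel, §12 proof of Lemma 12.2, p. 69] -/
theorem U022_holds : U022 := by
  refine ⟨3, fun D _ χ hD _ _ n hn1 hn2 => ?_⟩
  have hP1pp : 0 < P1pp D := P1pp_pos hD
  have hn0 : (0 : ℝ) < n := lt_trans hP1pp hn1
  set x : ℝ := n / P1pp D with hx_def
  have hx : 0 < x := div_pos hn0 hP1pp
  have hx0 : ((x : ℝ) : ℂ) ≠ 0 := by exact_mod_cast hx.ne'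
  have hv : vk13 D n =
      ((Real.log (Skeleton.P1 D))⁻¹ : ℝ) * ((x : ℝ) : ℂ) ^ (-beta6 D) * (Real.log x : ℂ) := by
    rw [vk13, if_pos ⟨hn1, hn2⟩]
  have hderiv : deriv (fun w : ℂ => ((x : ℝ) : ℂ) ^ (beta6 D - w)) 0 =
      -(((x : ℝ) : ℂ) ^ beta6 D * Complex.log x) := by
    have hc : HasDerivAt (fun w : ℂ => beta6 D - w) (-1) 0 := by
      simpa using (hasDerivAt_id (0 : ℂ)).const_sub (beta6 D)
    have h1 := ((Complex.hasStrictDerivAt_const_cpow (Or.inl hx0)).hasDerivAt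
      (x := beta6 D - 0)).comp 0 hc
    have h2 : HasDerivAt (fun w : ℂ => ((x : ℝ) : ℂ) ^ (beta6 D - w))
        (((x : ℝ) : ℂ) ^ (beta6 D - 0) * Complex.log x * -1) 0 := h1
    rw [h2.deriv]
    simp
  rw [hv, hderiv]
  have hlogx : Complex.log (x : ℂ) = (Real.log x : ℂ) := (Complex.ofReal_log hx.le).symm
  have hconj : conj (((x : ℝ) : ℂ) ^ (-beta6 D)) = ((x : ℝ) : ℂ) ^ beta6 D := by
    have harg : ((x : ℝ) : ℂ).arg ≠ π := by
      rw [Complex.arg_ofReal_of_nonneg hx.le]; exact Real.pi_pos.ne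
    have := Complex.cpow_conj ((x : ℝ) : ℂ) (-beta6 D) harg
    rw [Complex.conj_ofReal, map_neg, conj_beta6, neg_neg] at this
    exact this.symm
  rw [map_mul, map_mul, hconj, Complex.conj_ofReal, Complex.conj_ofReal, hlogx]
  push_cast
  ring

/-- **Z22:§12.u023** — "Hence `Σ_l χ(l)ϰ̄₁₃(drl)ξ_j(l;d,r)/l =
−(1/log P₁)·∂_w((dr/P″₁)^{β₆−w}Σ_{P″₁/dr<l<P″₂/dr} χ(l)ξ_j(l;d,r)/l^{1−β₆+w})|_{w=0}`" (an exact
identity: `(drl/P″₁)^{β₆−w} = (dr/P″₁)^{β₆−w}l^{β₆−w}` and linearity of `∂_w` over the finite sum).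
CLAIM. [cite: Zhang2022LandauSiegel, §12 proof of Lemma 12.2, p. 69] [Z22 p.69, tex L3523] -/
def U023 : Prop :=
  ForAllLarge fun D _ χ => ∀ j ∈ ({1, 2, 3} : Finset ℕ), ∀ d r : ℕ, 1 ≤ d → 1 ≤ r →
    sum122 c' χ j d r = -(1 / (Real.log (Skeleton.P1 D) : ℂ)) * deriv (bracket122 c' χ j d r) 0

/-- **Z22:§12.u024** — "Suppose `dr ≤ P″₁/T`. By (4) and (4) [sic], for `|w| = α` we have
`Σ_{P″₁/dr<l<P″₂/dr} χ(l)ξ_j(l;d,r)/l^{1−β₆+w} = Σ_l χ(l)ξ_j(l;d,r)/l^{1−β₆+w}{g(P″₂/(drl)) −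
g(P″₁/(drl))} + O(𝓛⁻¹⁵) = (2πi)⁻¹∫_{(1)}(Σ_l χ(l)ξ_j(l;d,r)/l^{1−β₆+w+s})((P″₂/dr)^s −
(P″₁/dr)^s)ω₁(s)ds/s + O(𝓛⁻¹⁵)`" — typed as the two `O(𝓛⁻¹⁵)`-approximations of the finite sum
(`innerSum`) by the `g`-weighted series (`gSeries`) and by the Perron integral (`lineInt024`). The
citation "(4) and (4)" is malformed in v1 (GAP candidate G·12c; presumably (4.2)–(4.3)). CLAIM.
[cite: Zhang2022LandauSiegel, §12 proof of Lemma 12.2, p. 69] [Z22 p.69, tex L3528] -/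
def U024 : Prop :=
  ∃ C : ℝ, ForAllLarge fun D _ χ => AssumptionA D χ →
    ∀ j ∈ ({1, 2, 3} : Finset ℕ), ∀ d r : ℕ, 1 ≤ d → 1 ≤ r →
      ((d * r : ℕ) : ℝ) ≤ P1pp D / bigT D → ∀ w : ℂ, ‖w‖ = alpha D →
        ‖innerSum c' χ j d r w - gSeries c' χ j d r w‖ ≤ C * (ell D ^ 15)⁻¹ ∧
        ‖innerSum c' χ j d r w - lineInt024 c' χ j d r w‖ ≤ C * (ell D ^ 15)⁻¹

/-- **Z22:§12.u025** — "In a way similar to the proof of Lemma 8.4, by lemma 8.2 and 5.8, we find that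
the right side above is equal to `L′(1,χ)Π(d,r)·(2πi)⁻¹∫_{|s|=5α}
(s+w−β₆+β_{j+1})(s+w−β₆+β_{j+2})/(s+w−β₆)·((P″₂/dr)^s − (P″₁/dr)^s)ds/s + O(𝓛⁻¹⁵)
= L′(1,χ)Π(d,r)β_{j+1}β_{j+2}((P″₂/dr)^{β₆−w} − (P″₁/dr)^{β₆−w})/(β₆−w) + O(𝓛⁻¹⁵)`" (`dr ≤ P″₁/T`,
`|w| = α`): the analytic evaluation of the Perron integral AND the residue computation of the circle
integral (its only pole inside `|s| = 5α` is `s = β₆ − w`, `|β₆ − w| ≤ 5α/2`; `s = 0` is removable).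
CLAIM. [cite: Zhang2022LandauSiegel, §12 proof of Lemma 12.2, p. 69] [Z22 p.69, tex L3534] -/
def U025 : Prop :=
  ∃ C : ℝ, ForAllLarge fun D _ χ => AssumptionA D χ →
    ∀ j ∈ ({1, 2, 3} : Finset ℕ), ∀ d r : ℕ, 1 ≤ d → 1 ≤ r →
      ((d * r : ℕ) : ℝ) ≤ P1pp D / bigT D → ∀ w : ℂ, ‖w‖ = alpha D →
        ‖lineInt024 c' χ j d r w -
            deriv χ.LFunction 1 * PiW χ d r * circ025 c' D j d r w‖ ≤ C * (ell D ^ 15)⁻¹ ∧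
        circ025 c' D j d r w =
          betaJ c' D (j + 1) * betaJ c' D (j + 2) *
            ((((P2pp D / ((d * r : ℕ) : ℝ) : ℝ) : ℂ) ^ (beta6 D - w) -
              ((P1pp D / ((d * r : ℕ) : ℝ) : ℝ) : ℂ) ^ (beta6 D - w)) / (beta6 D - w))

/-- **Z22:§12.u026, AS PRINTED** — "It follows by Cauchy' integral formula that
`∂_w((dr/P″₁)^{β₆−w}Σ_{P″₁/dr<l<P″₂/dr} χ(l)ξ_j(l;d,r)/l^{1−β₆+w})|_{w=0} =
∂_w(∫₁^{P^{0.004}} y^{β₆−w−1}dy)|_{w=0} + O(𝓛⁻⁶)`" — typed VERBATIM: the factor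
`L′(1,χ)Π(d,r)β_{j+1}β_{j+2}` carried by the preceding display does not appear in print (with it:
`U026read`; note `(dr/P″₁)^{β₆−w}[(P″₂/dr)^{β₆−w} − (P″₁/dr)^{β₆−w}]/(β₆−w) = ∫₁^{P^{0.004}}y^{β₆−w−1}dy`
since `P″₂/P″₁ = P^{0.004}`). CLAIM (as printed). [cite: Zhang2022LandauSiegel, §12 proof of Lemma 12.2,
pp. 69–70] [Z22 p.69, tex L3541] -/
def U026 : Prop :=
  ∃ C : ℝ, ForAllLarge fun D _ χ => AssumptionA D χ →
    ∀ j ∈ ({1, 2, 3} : Finset ℕ), ∀ d r : ℕ, 1 ≤ d → 1 ≤ r →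
      ((d * r : ℕ) : ℝ) ≤ P1pp D / bigT D →
        ‖deriv (bracket122 c' χ j d r) 0 - deriv (modelInt026 D) 0‖ ≤ C * (ell D ^ 6)⁻¹

/-- **Z22:§12.u026, with the factor of the preceding display restored** (the reading under which the
next sentence "Gathering these results together we obtain (12.10)" produces the printed main term
`b*L′(1,χ)Π(d,r)(log P)β_{j+1}β_{j+2}`): `∂_w(bracket)|₀ = L′(1,χ)Π(d,r)β_{j+1}β_{j+2}·
∂_w(∫₁^{P^{0.004}}y^{β₆−w−1}dy)|₀ + O(𝓛⁻⁶)`. A READING, recorded next to the verbatim `U026`. CLAIM.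
[cite: Zhang2022LandauSiegel, §12 proof of Lemma 12.2, pp. 69–70] [Z22 p.69, tex L3541] -/
def U026read : Prop :=
  ∃ C : ℝ, ForAllLarge fun D _ χ => AssumptionA D χ →
    ∀ j ∈ ({1, 2, 3} : Finset ℕ), ∀ d r : ℕ, 1 ≤ d → 1 ≤ r →
      ((d * r : ℕ) : ℝ) ≤ P1pp D / bigT D →
        ‖deriv (bracket122 c' χ j d r) 0 -
            deriv χ.LFunction 1 * PiW χ d r * betaJ c' D (j + 1) * betaJ c' D (j + 2) *
              deriv (modelInt026 D) 0‖ ≤ C * (ell D ^ 6)⁻¹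

/-- **Z22:§12.u027** — "The main term on the right side is, by substituting `y = P^z`, equal to
`−(log P)²∫₀^{0.004} z e^{3πiz/2}dz`" (`P^{zβ₆} = e^{3πiz/2}` as `α log P = π`): the identity
`∂_w(∫₁^{P^{0.004}}y^{β₆−w−1}dy)|_{w=0} = −(log P)²∫₀^{0.004} z e^{3πiz/2}dz`. CLAIM (exact identity).
[cite: Zhang2022LandauSiegel, §12 proof of Lemma 12.2, p. 70] [Z22 p.70, tex L3546] -/
def U027 : Prop :=
  ForAllLarge fun D _ _ =>
    deriv (modelInt026 D) 0 =
      -((Real.log (bigP D) : ℂ) ^ 2) * ∫ z in (0 : ℝ)..0.004, (z : ℂ) * cexp (3 * π * I * z / 2)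

end LemmaTwelveTwo

/-! ## Lemma 12.3 and its proof (pp. 70–71) -/

section LemmaTwelveThree

variable (c' : ℝ)

/-- **Z22:Lem12.3 / Z22:§12.u028 — Lemma 12.3** is the landed skeleton node `Skeleton.Lemma123 c′`
(p409865; AS PRINTED, `|ε₂ⱼ(dr)| < 10⁻⁵`, `P″₁ < dr < P₂`); referenced, not re-typed (its single
display u028 is the statement itself). [cite: Zhang2022LandauSiegel, §12 Lemma 12.3, p. 70]
[Z22 p.70, tex L3551–L3552] -/
abbrev lemma123 : Prop := Skeleton.Lemma123 c'

/-- **Z22:Lem12.3.pf — the proof of Lemma 12.3 as ONE named implication**: "In a way similar to the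
proof of Lemma 12.1 [sic: the displayed route is that of Lemma 12.2 — Lemma 8.3-type evaluation on
`|s| = 5α` and Lemma 5.8], we deduce …", "By direct calculation", and the rewriting with `ε₂ⱼ`. Typed
with the same inputs as `Ded122`. CLAIM (deduction node).
[cite: Zhang2022LandauSiegel, §12 proof of Lemma 12.3, pp. 70–71] [Z22 p.70, tex L3558] -/
def Ded123 : Prop := Lemma82 c' → Lemma83 c' → Lemma84 c' → Lemma58 → Skeleton.Lemma123 c'

/-- **Z22:§12.u029** — "The left side is equal to
`−(1/log P₁)·∂_w((dr/P″₁)^{β₆−w}Σ_{l<P″₂/dr} χ(l)ξ_j(l;d,r)/l^{1−β₆+w})|_{w=0}`" (for `P″₁ < dr < P₂`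
the constraint `P″₁ < drl` is automatic; an exact identity as in u023). CLAIM.
[cite: Zhang2022LandauSiegel, §12 proof of Lemma 12.3, p. 70] [Z22 p.70, tex L3559] -/
def U029 : Prop :=
  ForAllLarge fun D _ χ => ∀ j ∈ ({1, 2, 3} : Finset ℕ), ∀ d r : ℕ, 1 ≤ d → 1 ≤ r →
    P1pp D < ((d * r : ℕ) : ℝ) → ((d * r : ℕ) : ℝ) < Skeleton.P2 D →
      sum122 c' χ j d r = -(1 / (Real.log (Skeleton.P1 D) : ℂ)) * deriv (bracket123 c' χ j d r) 0

/-- **Z22:§12.u030** — "Assume `|w| = α`. In a way similar to the proof of Lemma 12.1 [sic], we deduce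
that `Σ_{l<P″₂/dr} χ(l)ξ_j(l;d,r)/l^{1−β₆+w} = L′(1,χ)Π(d,r)×·(2πi)⁻¹∫_{|s|=5α}
(s+w−β₆+β_{j+1})(s+w−β₆+β_{j+2})/(s+w−β₆)·(P″₂/dr)^s/s ds + O(𝓛⁻¹⁵)`" (`P″₁ < dr < P₂`). CLAIM.
[cite: Zhang2022LandauSiegel, §12 proof of Lemma 12.3, p. 70] [Z22 p.70, tex L3564] -/
def U030 : Prop :=
  ∃ C : ℝ, ForAllLarge fun D _ χ => AssumptionA D χ →
    ∀ j ∈ ({1, 2, 3} : Finset ℕ), ∀ d r : ℕ, 1 ≤ d → 1 ≤ r →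
      P1pp D < ((d * r : ℕ) : ℝ) → ((d * r : ℕ) : ℝ) < Skeleton.P2 D → ∀ w : ℂ, ‖w‖ = alpha D →
        ‖innerSumLow c' χ j d r w - deriv χ.LFunction 1 * PiW χ d r * circ030 c' D j d r w‖ ≤
          C * (ell D ^ 15)⁻¹

/-- **Z22:§12.u031** — "By direct calculation, `(2πi)⁻¹∫_{|s|=5α}
(s+w−β₆+β_{j+1})(s+w−β₆+β_{j+2})/(s+w−β₆)·(P″₂/dr)^s/s ds
= w − β₆ + β_{j+1} + β_{j+2} + β_{j+1}β_{j+2}∫₁^{P″/dr} y^{β₆−w−1}dy`" (`P″` [sic] = `P″₂`; `|w| = α`;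
the residues at `s = 0` and `s = β₆ − w`). CLAIM (exact identity).
[cite: Zhang2022LandauSiegel, §12 proof of Lemma 12.3, p. 70] [Z22 p.70, tex L3571] -/
def U031 : Prop :=
  ForAllLarge fun D _ _ => ∀ j ∈ ({1, 2, 3} : Finset ℕ), ∀ d r : ℕ, 1 ≤ d → 1 ≤ r →
    P1pp D < ((d * r : ℕ) : ℝ) → ((d * r : ℕ) : ℝ) < Skeleton.P2 D → ∀ w : ℂ, ‖w‖ = alpha D →
      circ030 c' D j d r w =
        w - beta6 D + betaJ c' D (j + 1) + betaJ c' D (j + 2) +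
          betaJ c' D (j + 1) * betaJ c' D (j + 2) *
            ∫ y in (1 : ℝ)..(P2pp D / ((d * r : ℕ) : ℝ)), (y : ℂ) ^ (beta6 D - w - 1)

/-- **Z22:§12.u033** — "the derivative of [`F032`] at `w = 0` is equal to [`rhs033`]" (product rule and
differentiation under the integral sign; exact). CLAIM.
[cite: Zhang2022LandauSiegel, §12 proof of Lemma 12.3, p. 70] [Z22 p.70, tex L3581] -/
def U033 : Prop :=
  ForAllLarge fun D _ _ => ∀ j ∈ ({1, 2, 3} : Finset ℕ), ∀ d r : ℕ, 1 ≤ d → 1 ≤ r →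
    P1pp D < ((d * r : ℕ) : ℝ) → ((d * r : ℕ) : ℝ) < Skeleton.P2 D →
      deriv (F032 c' D j d r) 0 = rhs033 c' D j d r

/-- **Z22:§12.u034** — "This can be written as the form `1 − (−2β₆+β_{j+1}+β_{j+2})log(dr/P″₁) −
ε₂ⱼ(dr)`, since `(dr/P″₁)^{β₆} = 1 + β₆log(dr/P″₁) + …`", with the bound `|ε₂ⱼ(dr)| < 10⁻⁵` of Lemma
12.3 (`P″₁ < dr < P₂`, `1 ≤ j ≤ 3`): a purely numerical claim about `rhs033` (no `χ` involved), kept as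
a BOUND. NUM:pending (read1 PRIOR on the size of `ε₂ⱼ` is a prior, not adjudicated here). CLAIM.
[cite: Zhang2022LandauSiegel, §12 proof of Lemma 12.3, p. 71] [Z22 p.71, tex L3587] -/
def U034 : Prop :=
  ForAllLarge fun D _ _ => ∀ j ∈ ({1, 2, 3} : Finset ℕ), ∀ d r : ℕ, 1 ≤ d → 1 ≤ r →
    P1pp D < ((d * r : ℕ) : ℝ) → ((d * r : ℕ) : ℝ) < Skeleton.P2 D →
      ‖rhs033 c' D j d r -
          (1 - (-2 * beta6 D + betaJ c' D (j + 1) + betaJ c' D (j + 2)) *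
            (Real.log (((d * r : ℕ) : ℝ) / P1pp D) : ℂ))‖ < 1e-5

end LemmaTwelveThree

/-! ## Discharges: the two "direct calculation" circle integrals (u031 and the second half of u025)

The residue computations the manuscript calls "direct calculation" (p. 70) and the closed form it
states after "similar to the proof of Lemma 8.4" (p. 69) are exact identities; they are PROVED here
from Cauchy's integral formula (Mathlib's `DifferentiableOn.circleIntegral_sub_inv_smul`) by partial
fractions, for `|w| = α` (so that `0 < |w − β₆| ≤ 5α/2 < 5α`: both poles `s = 0`, `s = β₆ − w` lie
inside `|s| = 5α`), and `∫₁^X y^{β₆−w−1}dy = (X^{β₆−w} − 1)/(β₆ − w)` (`integral_cpow`). -/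

section Discharges

variable (c' : ℝ)

/-- `|β₆| = 3α/2` (`β₆ = 3iα/2`, (2.22)). [cite: Zhang2022LandauSiegel, §2 (2.22)] -/
private theorem norm_beta6_aux {D : ℕ} (hD : 3 ≤ D) : ‖beta6 D‖ = 3 * alpha D / 2 := by
  have hα : 0 < alpha D := by
    rw [alpha, bigP, Real.log_exp]
    exact div_pos Real.pi_pos (pow_pos (Real.log_pos (by exact_mod_cast (by omega : 1 < D))) 9)
  rw [beta6]
  simp [Complex.norm_real, abs_of_pos hα]

/-- `P″₂ = P^{0.5}Dt₀ > 0` for `D ≥ 3`. [cite: Zhang2022LandauSiegel, §12 p. 67] -/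
private theorem P2pp_pos_aux {D : ℕ} (hD : 3 ≤ D) : 0 < P2pp D := by
  have hD' : (3 : ℝ) ≤ D := by exact_mod_cast hD
  have hlog : 0 < ell D := by
    rw [ell]; exact Real.log_pos (by linarith)
  have ht0 : 0 < t0 D := by rw [t0]; exact pow_pos hlog _
  have hP : 0 < bigP D ^ (0.5 : ℝ) := Real.rpow_pos_of_pos (Real.exp_pos _) _
  rw [P2pp]
  positivity

/-- The pole bookkeeping of the `|w| = α` computations (pp. 69–70): `w − β₆ ≠ 0` and
`|w − β₆| < 5α`, so `s = β₆ − w` lies inside the circle `|s| = 5α` and is distinct from `s = 0`.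
[cite: Zhang2022LandauSiegel, §12 proof of Lemma 12.2, p. 69] -/
theorem pole_aux {D : ℕ} (hD : 3 ≤ D) {w : ℂ} (hw : ‖w‖ = alpha D) :
    w - beta6 D ≠ 0 ∧ ‖w - beta6 D‖ < 5 * alpha D := by
  have hα : 0 < alpha D := by
    rw [alpha, bigP, Real.log_exp]
    exact div_pos Real.pi_pos (pow_pos (Real.log_pos (by exact_mod_cast (by omega : 1 < D))) 9)
  have hb := norm_beta6_aux hD
  constructor
  · intro h
    rw [sub_eq_zero] at h
    rw [h, hb] at hw
    linarith
  · calc ‖w - beta6 D‖ ≤ ‖w‖ + ‖beta6 D‖ := norm_sub_le _ _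
      _ = alpha D + 3 * alpha D / 2 := by rw [hw, hb]
      _ < 5 * alpha D := by linarith

open Metric in
/-- **Two simple poles inside the circle** (the "direct calculation" of pp. 69–70 in general form):
for `G` holomorphic on the closed disc `|s| ≤ R` and `0 < |a₀| < R`,
`(2πi)⁻¹∮_{|s|=R} G(s)/((s + a₀)s) ds = (G(0) − G(−a₀))/a₀` — partial fractions
`1/((s+a₀)s) = a₀⁻¹(1/s − 1/(s+a₀))` and Cauchy's integral formula twice.
[cite: Zhang2022LandauSiegel, §12 proof of Lemma 12.3, p. 70] -/
theorem circ_two_poles {R : ℝ} {a₀ : ℂ} (ha : a₀ ≠ 0) (haR : ‖a₀‖ < R) {G : ℂ → ℂ}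
    (hG : DifferentiableOn ℂ G (closedBall 0 R)) :
    (2 * π * I)⁻¹ * (∮ s in C(0, R), G s / ((s + a₀) * s)) = (G 0 - G (-a₀)) / a₀ := by
  have hR : 0 < R := lt_of_le_of_lt (norm_nonneg _) haR
  have h0 : (0 : ℂ) ∈ ball (0 : ℂ) R := by simp [hR]
  have ha' : (-a₀) ∈ ball (0 : ℂ) R := by simpa using haR
  have hcongr : (∮ s in C(0, R), G s / ((s + a₀) * s)) =
      ∮ s in C(0, R), a₀⁻¹ • ((s - 0)⁻¹ • G s - (s - (-a₀))⁻¹ • G s) := by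
    refine circleIntegral.integral_congr hR.le fun s hs => ?_
    have hsR : ‖s‖ = R := by simpa using hs
    have hs0 : s ≠ 0 := by
      intro h; rw [h, norm_zero] at hsR; linarith
    have hsa : s + a₀ ≠ 0 := by
      intro h
      have : s = -a₀ := eq_neg_of_add_eq_zero_left h
      rw [this, norm_neg] at hsR; linarith
    simp only [smul_eq_mul, sub_zero, sub_neg_eq_add]
    field_simp
    ring
  have hGc : ContinuousOn G (sphere (0 : ℂ) R) := hG.continuousOn.mono sphere_subset_closedBall
  have hci : ∀ v : ℂ, v ∈ ball (0 : ℂ) R →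
      CircleIntegrable (fun s => (s - v)⁻¹ • G s) 0 R := by
    intro v hv
    refine ContinuousOn.circleIntegrable hR.le ?_
    have hinv : ContinuousOn (fun s : ℂ => (s - v)⁻¹) (sphere (0 : ℂ) R) := by
      refine ContinuousOn.inv₀ (continuousOn_id.sub continuousOn_const) fun s hs => ?_
      have hsR : ‖s‖ = R := by simpa using hs
      have hvR : ‖v‖ < R := by simpa using hv
      intro h
      rw [sub_eq_zero] at h
      rw [h] at hsR
      linarith
    exact hinv.smul hGc
  rw [hcongr, circleIntegral.integral_smul, circleIntegral.integral_sub (hci 0 h0) (hci _ ha'),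
    hG.circleIntegral_sub_inv_smul h0, hG.circleIntegral_sub_inv_smul ha']
  simp only [smul_eq_mul]
  have h2pi : (2 * π * I : ℂ) ≠ 0 := by
    simp [Real.pi_ne_zero, Complex.I_ne_zero]
  field_simp

open Metric in
/-- The numerator `G(s) = (s + a₀ + β_{j+1})(s + a₀ + β_{j+2})X^s` of the circle integral of p. 70
(`X = P″₂/dr > 0`) is entire. [cite: Zhang2022LandauSiegel, §12 proof of Lemma 12.3, p. 70] -/
theorem differentiableOn_G (a₀ B₁ B₂ : ℂ) {X : ℝ} (hX : 0 < X) (S : Set ℂ) :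
    DifferentiableOn ℂ (fun s : ℂ => (s + a₀ + B₁) * (s + a₀ + B₂) * ((X : ℝ) : ℂ) ^ s) S := by
  have hX0 : ((X : ℝ) : ℂ) ≠ 0 := by exact_mod_cast hX.ne'
  intro s _
  refine DifferentiableAt.differentiableWithinAt ?_
  refine DifferentiableAt.mul (DifferentiableAt.mul ?_ ?_) ?_
  · fun_prop
  · fun_prop
  · exact differentiableAt_id.const_cpow (Or.inl hX0)

open Metric in
/-- The numerator `G(s) = (s + a₀ + β_{j+1})(s + a₀ + β_{j+2})(X₂^s − X₁^s)` of the circle integral of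
p. 69 (`X₂ = P″₂/dr`, `X₁ = P″₁/dr`) is entire and vanishes at `s = 0`.
[cite: Zhang2022LandauSiegel, §12 proof of Lemma 12.2, p. 69] -/
theorem differentiableOn_G2 (a₀ B₁ B₂ : ℂ) {X₁ X₂ : ℝ} (hX₁ : 0 < X₁) (hX₂ : 0 < X₂) (S : Set ℂ) :
    DifferentiableOn ℂ (fun s : ℂ => (s + a₀ + B₁) * (s + a₀ + B₂) *
      (((X₂ : ℝ) : ℂ) ^ s - ((X₁ : ℝ) : ℂ) ^ s)) S := by
  have h1 : ((X₁ : ℝ) : ℂ) ≠ 0 := by exact_mod_cast hX₁.ne'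
  have h2 : ((X₂ : ℝ) : ℂ) ≠ 0 := by exact_mod_cast hX₂.ne'
  intro s _
  refine DifferentiableAt.differentiableWithinAt ?_
  refine DifferentiableAt.mul (DifferentiableAt.mul ?_ ?_) ?_
  · fun_prop
  · fun_prop
  · exact (differentiableAt_id.const_cpow (Or.inl h2)).sub
      (differentiableAt_id.const_cpow (Or.inl h1))

/-- **Z22:§12.u031 holds** — the "direct calculation" of the proof of Lemma 12.3 is correct as
printed: `(2πi)⁻¹∫_{|s|=5α}(s+w−β₆+β_{j+1})(s+w−β₆+β_{j+2})/(s+w−β₆)·(P″₂/dr)^s/s ds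
= w − β₆ + β_{j+1} + β_{j+2} + β_{j+1}β_{j+2}∫₁^{P″₂/dr} y^{β₆−w−1}dy` for `|w| = α` (residues at
`s = 0` and `s = β₆ − w`). Kernel-checked; the node is DISCHARGED.
[cite: Zhang2022LandauSiegel, §12 proof of Lemma 12.3, p. 70] -/
theorem U031_holds : U031 c' := by
  refine ⟨3, fun D _ χ hD _ _ j _ d r hd hr _ _ w hw => ?_⟩
  obtain ⟨ha0, haR⟩ := pole_aux hD hw
  have hbw0 : beta6 D - w ≠ 0 := by
    intro h; apply ha0; linear_combination -h
  have hdr : (0 : ℝ) < ((d * r : ℕ) : ℝ) := by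
    have : 1 ≤ d * r := Nat.one_le_iff_ne_zero.mpr (Nat.mul_ne_zero (by omega) (by omega))
    exact_mod_cast lt_of_lt_of_le zero_lt_one this
  have hX : 0 < P2pp D / ((d * r : ℕ) : ℝ) := div_pos (P2pp_pos_aux hD) hdr
  have key := circ_two_poles ha0 haR (differentiableOn_G (w - beta6 D) (betaJ c' D (j + 1))
    (betaJ c' D (j + 2)) hX (Metric.closedBall 0 (5 * alpha D)))
  have hcirc : circ030 c' D j d r w = (2 * π * I)⁻¹ *
      (∮ s in C(0, 5 * alpha D), (s + (w - beta6 D) + betaJ c' D (j + 1)) *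
        (s + (w - beta6 D) + betaJ c' D (j + 2)) *
          ((P2pp D / ((d * r : ℕ) : ℝ) : ℝ) : ℂ) ^ s / ((s + (w - beta6 D)) * s)) := by
    rw [circ030]
    congr 1
    congr 1
    funext s
    rw [div_mul_div_comm]
    ring
  rw [hcirc.trans key]
  -- the integral in closed form
  have hint : (∫ y in (1 : ℝ)..(P2pp D / ((d * r : ℕ) : ℝ)), (y : ℂ) ^ (beta6 D - w - 1)) =
      ((((P2pp D / ((d * r : ℕ) : ℝ) : ℝ) : ℂ)) ^ (beta6 D - w) - 1) / (beta6 D - w) := by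
    have hne : beta6 D - w - 1 ≠ -1 := by
      intro h
      apply hbw0
      linear_combination h
    have h0 : (0 : ℝ) ∉ Set.uIcc (1 : ℝ) (P2pp D / ((d * r : ℕ) : ℝ)) := by
      intro h
      rcases Set.mem_uIcc.mp h with ⟨h1, _⟩ | ⟨h1, _⟩ <;> linarith
    rw [integral_cpow (Or.inr ⟨hne, h0⟩)]
    have e1 : beta6 D - w - 1 + 1 = beta6 D - w := by ring
    rw [e1, Complex.ofReal_one, Complex.one_cpow]
  simp only [neg_sub, zero_add, Complex.cpow_zero, mul_one]
  rw [hint]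
  field_simp
  ring

/-- **The second half of Z22:§12.u025 holds** — the closed form of the circle integral of p. 69:
`(2πi)⁻¹∫_{|s|=5α}(s+w−β₆+β_{j+1})(s+w−β₆+β_{j+2})/(s+w−β₆)·((P″₂/dr)^s − (P″₁/dr)^s)/s ds
= β_{j+1}β_{j+2}((P″₂/dr)^{β₆−w} − (P″₁/dr)^{β₆−w})/(β₆ − w)` for `|w| = α` (the numerator vanishes at
`s = 0`, so only the residue at `s = β₆ − w` contributes). Kernel-checked (the analytic first half
of u025 remains a CLAIM). [cite: Zhang2022LandauSiegel, §12 proof of Lemma 12.2, p. 69] -/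
theorem circ025_eq : ForAllLarge fun D _ _ => ∀ j ∈ ({1, 2, 3} : Finset ℕ), ∀ d r : ℕ,
    1 ≤ d → 1 ≤ r → ∀ w : ℂ, ‖w‖ = alpha D →
      circ025 c' D j d r w =
        betaJ c' D (j + 1) * betaJ c' D (j + 2) *
          ((((P2pp D / ((d * r : ℕ) : ℝ) : ℝ) : ℂ) ^ (beta6 D - w) -
            ((P1pp D / ((d * r : ℕ) : ℝ) : ℝ) : ℂ) ^ (beta6 D - w)) / (beta6 D - w)) := by
  refine ⟨3, fun D _ χ hD _ _ j _ d r hd hr w hw => ?_⟩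
  obtain ⟨ha0, haR⟩ := pole_aux hD hw
  have hbw0 : beta6 D - w ≠ 0 := by
    intro h; apply ha0; linear_combination -h
  have hdr : (0 : ℝ) < ((d * r : ℕ) : ℝ) := by
    have : 1 ≤ d * r := Nat.one_le_iff_ne_zero.mpr (Nat.mul_ne_zero (by omega) (by omega))
    exact_mod_cast lt_of_lt_of_le zero_lt_one this
  have hX₂ : 0 < P2pp D / ((d * r : ℕ) : ℝ) := div_pos (P2pp_pos_aux hD) hdr
  have hX₁ : 0 < P1pp D / ((d * r : ℕ) : ℝ) := div_pos (P1pp_pos hD) hdr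
  have key := circ_two_poles ha0 haR (differentiableOn_G2 (w - beta6 D) (betaJ c' D (j + 1))
    (betaJ c' D (j + 2)) hX₁ hX₂ (Metric.closedBall 0 (5 * alpha D)))
  have hcirc : circ025 c' D j d r w = (2 * π * I)⁻¹ *
      (∮ s in C(0, 5 * alpha D), (s + (w - beta6 D) + betaJ c' D (j + 1)) *
        (s + (w - beta6 D) + betaJ c' D (j + 2)) *
          (((P2pp D / ((d * r : ℕ) : ℝ) : ℝ) : ℂ) ^ s -
              ((P1pp D / ((d * r : ℕ) : ℝ) : ℝ) : ℂ) ^ s) / ((s + (w - beta6 D)) * s)) := by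
    rw [circ025]
    congr 1
    congr 1
    funext s
    rw [div_mul_div_comm]
    ring
  rw [hcirc.trans key]
  simp only [neg_sub, zero_add, Complex.cpow_zero, sub_self, mul_zero, zero_sub]
  field_simp
  ring

/-! ### The two derivative "direct calculations": u033 (Lemma 12.3) and u027 (Lemma 12.2)

Closed forms: `∫₁^X y^{c−1}dy = (X^c − 1)/c`, `∂_w X^{c−w} = −X^{c−w}log X`, hence
`∂_w(∫₁^X y^{c−w−1}dy)|₀ = (−cX^c log X + X^c − 1)/c²`; `∫₁^X y^{c−1}log y dy = (X^c(c log X − 1) + 1)/c²`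
(antiderivative `y^c(c log y − 1)/c²`); `∫₀^a z e^{kz}dz = (a/k − 1/k²)e^{ka} + 1/k²`. -/

/-- `∫₁^X y^{c−1} dy = (X^c − 1)/c` for `X > 0`, `c ≠ 0` (Mathlib's `integral_cpow`).
[cite: Zhang2022LandauSiegel, §12 proof of Lemma 12.3, p. 70] -/
theorem integral_cpow_sub_one {X : ℝ} (hX : 0 < X) {c : ℂ} (hc : c ≠ 0) :
    (∫ y in (1 : ℝ)..X, (y : ℂ) ^ (c - 1)) = (((X : ℝ) : ℂ) ^ c - 1) / c := by
  have hne : c - 1 ≠ -1 := fun h => hc (by linear_combination h)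
  have h0 : (0 : ℝ) ∉ Set.uIcc (1 : ℝ) X := by
    intro h; rcases Set.mem_uIcc.mp h with ⟨h1, _⟩ | ⟨h1, _⟩ <;> linarith
  rw [integral_cpow (Or.inr ⟨hne, h0⟩), sub_add_cancel, Complex.ofReal_one, Complex.one_cpow]

/-- `∂_w A^{c−w} = −A^{c−w}log A` for real `A > 0` (used in u022, u026, u033).
[cite: Zhang2022LandauSiegel, §12 proof of Lemma 12.2, p. 69] -/
theorem hasDerivAt_const_cpow_sub {A : ℝ} (hA : 0 < A) (c w₀ : ℂ) :
    HasDerivAt (fun w : ℂ => ((A : ℝ) : ℂ) ^ (c - w))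
      (-(((A : ℝ) : ℂ) ^ (c - w₀) * (Real.log A : ℂ))) w₀ := by
  have hA0 : ((A : ℝ) : ℂ) ≠ 0 := by exact_mod_cast hA.ne'
  have hc : HasDerivAt (fun w : ℂ => c - w) (-1) w₀ := by
    simpa using (hasDerivAt_id w₀).const_sub c
  have h1 := ((Complex.hasStrictDerivAt_const_cpow (Or.inl hA0)).hasDerivAt
    (x := c - w₀)).comp w₀ hc
  have h2 : HasDerivAt (fun w : ℂ => ((A : ℝ) : ℂ) ^ (c - w))
      (((A : ℝ) : ℂ) ^ (c - w₀) * Complex.log A * -1) w₀ := h1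
  convert h2 using 1
  rw [← Complex.ofReal_log hA.le]
  ring

/-- **The parametric integral** `I(w) = ∫₁^X y^{c−w−1}dy` has
`I′(0) = (−cX^c log X + X^c − 1)/c²` (`X > 0`, `c ≠ 0`): near `w = 0`, `I(w) = (X^{c−w} − 1)/(c − w)`
and the quotient rule applies. [cite: Zhang2022LandauSiegel, §12 proof of Lemma 12.3, p. 70] -/
theorem hasDerivAt_paramInt {X : ℝ} (hX : 0 < X) {c : ℂ} (hc : c ≠ 0) :
    HasDerivAt (fun w : ℂ => ∫ y in (1 : ℝ)..X, (y : ℂ) ^ (c - w - 1))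
      ((-(c * ((X : ℝ) : ℂ) ^ c * (Real.log X : ℂ)) + ((X : ℝ) : ℂ) ^ c - 1) / c ^ 2) 0 := by
  have heq : (fun w : ℂ => ∫ y in (1 : ℝ)..X, (y : ℂ) ^ (c - w - 1)) =ᶠ[nhds 0]
      (fun w : ℂ => (((X : ℝ) : ℂ) ^ (c - w) - 1) / (c - w)) := by
    have hopen : ∀ᶠ w in nhds (0 : ℂ), c - w ≠ 0 := by
      have hcont : Continuous fun w : ℂ => c - w := by fun_prop
      have hop : IsOpen ((fun w : ℂ => c - w) ⁻¹' {0}ᶜ) := isOpen_compl_singleton.preimage hcont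
      exact hop.mem_nhds (by simpa using hc)
    filter_upwards [hopen] with w hw
    exact integral_cpow_sub_one hX hw
  have hnum : HasDerivAt (fun w : ℂ => ((X : ℝ) : ℂ) ^ (c - w) - 1)
      (-(((X : ℝ) : ℂ) ^ (c - 0) * (Real.log X : ℂ))) 0 :=
    (hasDerivAt_const_cpow_sub hX c 0).sub_const 1
  have hden : HasDerivAt (fun w : ℂ => c - w) (-1) 0 := by
    simpa using (hasDerivAt_id (0 : ℂ)).const_sub c
  have hquot := hnum.div hden (by simpa using hc)
  have hval : ((-(c * ((X : ℝ) : ℂ) ^ c * (Real.log X : ℂ)) + ((X : ℝ) : ℂ) ^ c - 1) / c ^ 2) =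
      (-(((X : ℝ) : ℂ) ^ (c - 0) * (Real.log X : ℂ)) * (c - 0) -
        (((X : ℝ) : ℂ) ^ (c - 0) - 1) * -1) / (c - 0) ^ 2 := by
    rw [sub_zero]
    field_simp
    ring
  rw [hval]
  exact hquot.congr_of_eventuallyEq heq

/-- `∫₁^X y^{c−1}log y dy = (X^c(c log X − 1) + 1)/c²` (`X > 0`, `c ≠ 0`), by the fundamental
theorem of calculus with the antiderivative `y^c(c log y − 1)/c²`.
[cite: Zhang2022LandauSiegel, §12 proof of Lemma 12.3, p. 70] -/
theorem integral_cpow_mul_log {X : ℝ} (hX : 0 < X) {c : ℂ} (hc : c ≠ 0) :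
    (∫ y in (1 : ℝ)..X, (y : ℂ) ^ (c - 1) * (Real.log y : ℂ)) =
      (((X : ℝ) : ℂ) ^ c * (c * (Real.log X : ℂ) - 1) + 1) / c ^ 2 := by
  have hpos : ∀ y ∈ Set.uIcc (1 : ℝ) X, 0 < y := by
    intro y hy
    rcases Set.mem_uIcc.mp hy with ⟨h1, _⟩ | ⟨h1, _⟩ <;> linarith
  have hderiv : ∀ y ∈ Set.uIcc (1 : ℝ) X,
      HasDerivAt (fun y : ℝ => ((y : ℝ) : ℂ) ^ c * (c * (Real.log y : ℂ) - 1) / c ^ 2)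
        (((y : ℝ) : ℂ) ^ (c - 1) * (Real.log y : ℂ)) y := by
    intro y hy
    have hy0 : 0 < y := hpos y hy
    have hy0' : ((y : ℝ) : ℂ) ≠ 0 := by exact_mod_cast hy0.ne'
    have h1 : HasDerivAt (fun y : ℝ => ((y : ℝ) : ℂ) ^ c) (c * ((y : ℝ) : ℂ) ^ (c - 1)) y :=
      (Complex.hasStrictDerivAt_cpow_const (c := c)
        (Complex.ofReal_mem_slitPlane.mpr hy0)).hasDerivAt.comp_ofReal
    have h2 : HasDerivAt (fun y : ℝ => (Real.log y : ℂ)) ((y⁻¹ : ℝ) : ℂ) y :=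
      (Real.hasDerivAt_log hy0.ne').ofReal_comp
    have h3 := (h1.fun_mul ((h2.const_mul c).sub_const 1)).div_const (c ^ 2)
    have h4 : HasDerivAt (fun y : ℝ => ((y : ℝ) : ℂ) ^ c * (c * (Real.log y : ℂ) - 1) / c ^ 2)
        ((c * ((y : ℝ) : ℂ) ^ (c - 1) * (c * (Real.log y : ℂ) - 1) +
          ((y : ℝ) : ℂ) ^ c * (c * ((y⁻¹ : ℝ) : ℂ))) / c ^ 2) y := h3
    refine h4.congr_deriv ?_
    rw [Complex.cpow_sub _ _ hy0', Complex.cpow_one]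
    push_cast
    field_simp
    ring
  have hint : IntervalIntegrable (fun y : ℝ => ((y : ℝ) : ℂ) ^ (c - 1) * (Real.log y : ℂ))
      MeasureTheory.volume 1 X := by
    refine ContinuousOn.intervalIntegrable fun y hy => ?_
    have hy0 : 0 < y := hpos y hy
    exact ((Complex.continuousAt_ofReal_cpow_const y (c - 1) (Or.inr hy0.ne')).mul
      (Complex.continuous_ofReal.continuousAt.comp (Real.continuousAt_log hy0.ne'))).continuousWithinAt
  rw [intervalIntegral.integral_eq_sub_of_hasDerivAt hderiv hint]
  simp only [Complex.ofReal_one, Complex.one_cpow, Real.log_one, Complex.ofReal_zero, mul_zero,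
    zero_sub, one_mul]
  field_simp
  ring

/-- `β₆ ≠ 0` (for `D ≥ 3`). [cite: Zhang2022LandauSiegel, §2 (2.22)] -/
theorem beta6_ne_zero {D : ℕ} (hD : 3 ≤ D) : beta6 D ≠ 0 := by
  intro h
  have h1 := norm_beta6_aux hD
  rw [h, norm_zero] at h1
  have hα : 0 < alpha D := by
    rw [alpha, bigP, Real.log_exp]
    exact div_pos Real.pi_pos (pow_pos (Real.log_pos (by exact_mod_cast (by omega : 1 < D))) 9)
  linarith

/-- **Z22:§12.u033 holds** — the displayed derivative of the proof of Lemma 12.3 is correct as printed: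
`∂_w[(dr/P″₁)^{β₆−w}(w − β₆ + β_{j+1} + β_{j+2} + β_{j+1}β_{j+2}∫₁^{P″₂/dr}y^{β₆−w−1}dy)]|_{w=0}
= (dr/P″₁)^{β₆}(1 − β_{j+1}β_{j+2}∫₁^{P″₂/dr}y^{β₆−1}log y dy)
− (dr/P″₁)^{β₆}log(dr/P″₁)(−β₆ + β_{j+1} + β_{j+2} + β_{j+1}β_{j+2}∫₁^{P″₂/dr}y^{β₆−1}dy)`
(product rule; the `w`-derivative of the integral is `−∫ y^{β₆−1}log y dy`, checked through the closed
forms above). Kernel-checked; the node is DISCHARGED. [cite: Zhang2022LandauSiegel, §12 proof of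
Lemma 12.3, p. 70] -/
theorem U033_holds : U033 c' := by
  refine ⟨3, fun D _ χ hD _ _ j _ d r hd hr _ _ => ?_⟩
  have hb6 : beta6 D ≠ 0 := beta6_ne_zero hD
  have hdr : (0 : ℝ) < ((d * r : ℕ) : ℝ) := by
    have : 1 ≤ d * r := Nat.one_le_iff_ne_zero.mpr (Nat.mul_ne_zero (by omega) (by omega))
    exact_mod_cast lt_of_lt_of_le zero_lt_one this
  have hX : 0 < P2pp D / ((d * r : ℕ) : ℝ) := div_pos (P2pp_pos_aux hD) hdr
  have hA : 0 < ((d * r : ℕ) : ℝ) / P1pp D := div_pos hdr (P1pp_pos hD)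
  have hf := hasDerivAt_const_cpow_sub hA (beta6 D) 0
  have hI := hasDerivAt_paramInt hX hb6
  have hg := ((((hasDerivAt_id' (0 : ℂ)).sub_const (beta6 D)).add_const
    (betaJ c' D (j + 1))).add_const (betaJ c' D (j + 2))).add
      (hI.const_mul (betaJ c' D (j + 1) * betaJ c' D (j + 2)))
  have hF : HasDerivAt (F032 c' D j d r) _ 0 := hf.fun_mul hg
  rw [hF.deriv, rhs033, integral_cpow_mul_log hX hb6]
  simp only [sub_zero]
  rw [integral_cpow_sub_one hX hb6]
  field_simp
  ring

/-- `∫₀^a z e^{kz}dz = (a/k − 1/k²)e^{ka} + 1/k²` for `k ≠ 0` (antiderivative `(z/k − 1/k²)e^{kz}`).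
[cite: Zhang2022LandauSiegel, §12 proof of Lemma 12.2, p. 70] -/
theorem integral_mul_cexp {k : ℂ} (hk : k ≠ 0) (a : ℝ) :
    (∫ z in (0 : ℝ)..a, (z : ℂ) * cexp (k * z)) =
      ((a : ℂ) / k - 1 / k ^ 2) * cexp (k * a) + 1 / k ^ 2 := by
  have hderiv : ∀ z ∈ Set.uIcc (0 : ℝ) a,
      HasDerivAt (fun z : ℝ => ((z : ℂ) / k - 1 / k ^ 2) * cexp (k * z))
        ((z : ℂ) * cexp (k * z)) z := by
    intro z _
    have h1 : HasDerivAt (fun s : ℂ => s / k - 1 / k ^ 2) (1 / k) (z : ℂ) :=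
      ((hasDerivAt_id' (z : ℂ)).div_const k).sub_const (1 / k ^ 2)
    have h2 : HasDerivAt (fun s : ℂ => cexp (k * s)) (cexp (k * z) * (k * 1)) (z : ℂ) :=
      ((hasDerivAt_id' (z : ℂ)).const_mul k).cexp
    have h3 := h1.fun_mul h2
    have h4 : HasDerivAt (fun z : ℝ => ((z : ℂ) / k - 1 / k ^ 2) * cexp (k * z))
        (1 / k * cexp (k * z) + ((z : ℂ) / k - 1 / k ^ 2) * (cexp (k * z) * (k * 1))) z :=
      h3.comp_ofReal
    refine h4.congr_deriv ?_
    field_simp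
    ring
  have hint : IntervalIntegrable (fun z : ℝ => (z : ℂ) * cexp (k * z))
      MeasureTheory.volume 0 a :=
    (by fun_prop : Continuous fun z : ℝ => (z : ℂ) * cexp (k * z)).intervalIntegrable _ _
  rw [intervalIntegral.integral_eq_sub_of_hasDerivAt hderiv hint]
  simp only [Complex.ofReal_zero, mul_zero, Complex.exp_zero, zero_div, zero_sub, mul_one]
  ring

/-- **Z22:§12.u027 holds** — "The main term on the right side is, by substituting `y = P^z`, equal to
`−(log P)²∫₀^{0.004} z e^{3πiz/2}dz`": `∂_w(∫₁^{P^{0.004}} y^{β₆−w−1}dy)|_{w=0} =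
−(log P)²∫₀^{0.004} z e^{3πiz/2}dz` exactly (`log P = 𝓛⁹`, `β₆ log P = 3πi/2`,
`(P^{0.004})^{β₆} = e^{0.006πi}`; both sides in closed form). Kernel-checked; the node is DISCHARGED.
[cite: Zhang2022LandauSiegel, §12 proof of Lemma 12.2, p. 70] -/
theorem U027_holds : U027 := by
  refine ⟨3, fun D _ χ hD _ _ => ?_⟩
  beta_reduce
  have hb6 : beta6 D ≠ 0 := beta6_ne_zero hD
  have hP : 0 < bigP D := Real.exp_pos _
  have hX : 0 < bigP D ^ (0.004 : ℝ) := Real.rpow_pos_of_pos hP _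
  have hM : HasDerivAt (modelInt026 D) _ 0 := hasDerivAt_paramInt hX hb6
  rw [hM.deriv]
  have hk : (3 * π * I / 2 : ℂ) ≠ 0 := by
    have hπ : (π : ℂ) ≠ 0 := by exact_mod_cast Real.pi_ne_zero
    have hI : (I : ℂ) ≠ 0 := Complex.I_ne_zero
    field_simp
    simp [hπ, hI]
  have hint : (∫ z in (0 : ℝ)..0.004, (z : ℂ) * cexp (3 * π * I * z / 2)) =
      ∫ z in (0 : ℝ)..0.004, (z : ℂ) * cexp ((3 * π * I / 2) * z) := by
    congr 1
    funext z
    ring_nf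
  rw [hint, integral_mul_cexp hk]
  have hD' : (3 : ℝ) ≤ D := by exact_mod_cast hD
  have hlog : 0 < ell D := by rw [ell]; exact Real.log_pos (by linarith)
  have hL : Real.log (bigP D) = ell D ^ 9 := by rw [bigP, Real.log_exp]
  have hLne : (ell D : ℂ) ≠ 0 := by exact_mod_cast hlog.ne'
  have hL0 : (ell D : ℂ) ^ 9 ≠ 0 := pow_ne_zero _ hLne
  have hlogX : Real.log (bigP D ^ (0.004 : ℝ)) = 0.004 * ell D ^ 9 := by
    rw [Real.log_rpow hP, hL]
  have hβ : beta6 D = (3 * π * I / 2) / ((ell D : ℂ) ^ 9) := by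
    rw [beta6, alpha, hL]
    push_cast
    field_simp
  have hXpow : (((bigP D ^ (0.004 : ℝ)) : ℝ) : ℂ) ^ beta6 D =
      cexp ((3 * π * I / 2) * ((0.004 : ℝ) : ℂ)) := by
    rw [Complex.cpow_def_of_ne_zero (by exact_mod_cast hX.ne'), ← Complex.ofReal_log hX.le,
      hlogX, hβ]
    congr 1
    push_cast
    field_simp
  rw [hXpow, hlogX, hβ, hL]
  push_cast
  field_simp
  ring

/-! ### The two "Hence … = −(1/log P₁)∂_w(…)|₀" identities: u023 (Lemma 12.2) and u029 (Lemma 12.3)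

`conj ϰ₁₃(drl) = (log P₁)⁻¹(drl/P″₁)^{β₆}log(drl/P″₁)` on `P″₁ < drl < P″₂` (else `0`),
`(drl/P″₁)^{β₆} = (dr/P″₁)^{β₆}l^{β₆}`, `log(drl/P″₁) = log(dr/P″₁) + log l`, `l^{β₆}/l = 1/l^{1−β₆}`, and
`∂_w[(dr/P″₁)^{β₆−w}Σ_l c_l/l^{1−β₆+w}]|₀ = −Σ_l c_l (dr/P″₁)^{β₆}(log(dr/P″₁) + log l)/l^{1−β₆}`
(product rule over the finite sum) give u023; for `dr > P″₁` the two index sets coincide (u029). -/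

/-- `∂_w (c/l^{e+w})|_{w=0} = −c·log l/l^{e}` for a natural number `l ≥ 1`.
[cite: Zhang2022LandauSiegel, §12 proof of Lemma 12.2, p. 69] -/
theorem hasDerivAt_const_div_natCpow (c e : ℂ) {l : ℕ} (hl : 1 ≤ l) :
    HasDerivAt (fun w : ℂ => c / ((l : ℕ) : ℂ) ^ (e + w))
      (-(c * (Real.log l : ℂ) / ((l : ℕ) : ℂ) ^ e)) 0 := by
  have hl0 : ((l : ℕ) : ℂ) ≠ 0 := by exact_mod_cast (by omega : l ≠ 0)
  have hlin : HasDerivAt (fun w : ℂ => e + w) 1 0 := (hasDerivAt_id' (0 : ℂ)).const_add e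
  have h1 := ((Complex.hasStrictDerivAt_const_cpow (Or.inl hl0)).hasDerivAt
    (x := e + 0)).comp 0 hlin
  have hd : HasDerivAt (fun w : ℂ => ((l : ℕ) : ℂ) ^ (e + w))
      (((l : ℕ) : ℂ) ^ (e + 0) * Complex.log l * 1) 0 := h1
  have hne : ((l : ℕ) : ℂ) ^ (e + 0) ≠ 0 := by
    rw [Ne, Complex.cpow_eq_zero_iff]; exact fun h => hl0 h.1
  have hq := (hasDerivAt_const (0 : ℂ) c).div hd hne
  have hq' : HasDerivAt (fun w : ℂ => c / ((l : ℕ) : ℂ) ^ (e + w))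
      ((0 * ((l : ℕ) : ℂ) ^ (e + 0) - c * (((l : ℕ) : ℂ) ^ (e + 0) * Complex.log l * 1)) /
        (((l : ℕ) : ℂ) ^ (e + 0)) ^ 2) 0 := hq
  refine hq'.congr_deriv ?_
  rw [add_zero, ← Complex.natCast_log]
  field_simp
  ring

/-- `(l^{1−β})⁻¹ = l^{β}·l⁻¹` for `l ≥ 1`. [cite: Zhang2022LandauSiegel, §12 proof of Lemma 12.2, p. 69] -/
theorem inv_natCpow_one_sub {l : ℕ} (hl : 1 ≤ l) (β : ℂ) :
    (((l : ℕ) : ℂ) ^ (1 - β))⁻¹ = ((l : ℕ) : ℂ) ^ β * ((l : ℕ) : ℂ)⁻¹ := by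
  have hl0 : ((l : ℕ) : ℂ) ≠ 0 := by exact_mod_cast (by omega : l ≠ 0)
  rw [Complex.cpow_sub _ _ hl0, Complex.cpow_one]
  have hne : ((l : ℕ) : ℂ) ^ β ≠ 0 := by
    rw [Ne, Complex.cpow_eq_zero_iff]; exact fun h => hl0 h.1
  field_simp

/-- **Z22:§12.u023 holds** — "Hence `Σ_l χ(l)ϰ̄₁₃(drl)ξ_j(l;d,r)/l =
−(1/log P₁)∂_w((dr/P″₁)^{β₆−w}Σ_{P″₁/dr<l<P″₂/dr} χ(l)ξ_j(l;d,r)/l^{1−β₆+w})|_{w=0}`" is an exact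
identity (for every `D ≥ 3`, `1 ≤ j`, `d, r ≥ 1`; no use of (A)). Kernel-checked; the node is
DISCHARGED. [cite: Zhang2022LandauSiegel, §12 proof of Lemma 12.2, p. 69] -/
theorem U023_holds : U023 c' := by
  refine ⟨3, fun D _ χ hD _ _ j _ d r hd hr => ?_⟩
  have hP1 : 0 < P1pp D := P1pp_pos hD
  have hdr : (0 : ℝ) < ((d * r : ℕ) : ℝ) := by
    have : 1 ≤ d * r := Nat.one_le_iff_ne_zero.mpr (Nat.mul_ne_zero (by omega) (by omega))
    exact_mod_cast lt_of_lt_of_le zero_lt_one this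
  have hA : 0 < ((d * r : ℕ) : ℝ) / P1pp D := div_pos hdr hP1
  -- derivative of the inner sum
  have hS : HasDerivAt (innerSum c' χ j d r)
      (∑ l ∈ (Finset.Ico 1 ⌈P2pp D⌉₊).filter
          (fun l : ℕ => P1pp D / ((d * r : ℕ) : ℝ) < l ∧ (l : ℝ) < P2pp D / ((d * r : ℕ) : ℝ)),
        -(χ (l : ZMod D) * xiZero c' D j l d r * (Real.log l : ℂ) /
          ((l : ℕ) : ℂ) ^ (1 - beta6 D))) 0 := by
    have key : ∀ l ∈ (Finset.Ico 1 ⌈P2pp D⌉₊).filter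
        (fun l : ℕ => P1pp D / ((d * r : ℕ) : ℝ) < l ∧ (l : ℝ) < P2pp D / ((d * r : ℕ) : ℝ)),
        HasDerivAt (fun w : ℂ => χ (l : ZMod D) * xiZero c' D j l d r /
            ((l : ℕ) : ℂ) ^ (1 - beta6 D + w))
          (-(χ (l : ZMod D) * xiZero c' D j l d r * (Real.log l : ℂ) /
            ((l : ℕ) : ℂ) ^ (1 - beta6 D))) 0 := by
      intro l hl
      have hl1 : 1 ≤ l := (Finset.mem_Ico.mp (Finset.mem_filter.mp hl).1).1
      exact hasDerivAt_const_div_natCpow _ _ hl1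
    have := HasDerivAt.fun_sum key
    exact this
  have hf := hasDerivAt_const_cpow_sub hA (beta6 D) 0
  have hB : HasDerivAt (bracket122 c' χ j d r) _ 0 := hf.fun_mul hS
  rw [hB.deriv, innerSum]
  simp only [sub_zero, add_zero]
  -- the left side as a filtered sum
  have hterm : ∀ l ∈ Finset.Ico 1 ⌈P2pp D⌉₊,
      χ (l : ZMod D) * conj (vk13 D (d * r * l)) * xiZero c' D j l d r / (l : ℂ) =
        if P1pp D / ((d * r : ℕ) : ℝ) < l ∧ (l : ℝ) < P2pp D / ((d * r : ℕ) : ℝ) then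
          χ (l : ZMod D) * (((1 / Real.log (Skeleton.P1 D) : ℝ) : ℂ) *
            (((((d * r : ℕ) : ℝ) / P1pp D : ℝ) : ℂ) ^ beta6 D * ((l : ℕ) : ℂ) ^ beta6 D) *
            ((Real.log (((d * r : ℕ) : ℝ) / P1pp D) : ℂ) + (Real.log l : ℂ))) *
            xiZero c' D j l d r / (l : ℂ)
        else 0 := by
    intro l hl
    have hl1 : 1 ≤ l := (Finset.mem_Ico.mp hl).1
    have hl0 : (0 : ℝ) < l := by exact_mod_cast hl1
    have hcast : (((d * r * l : ℕ) : ℝ)) = ((d * r : ℕ) : ℝ) * l := by push_cast; ring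
    by_cases hc : P1pp D / ((d * r : ℕ) : ℝ) < l ∧ (l : ℝ) < P2pp D / ((d * r : ℕ) : ℝ)
    · rw [if_pos hc]
      have hc' : P1pp D < ((d * r * l : ℕ) : ℝ) ∧ ((d * r * l : ℕ) : ℝ) < P2pp D := by
        rw [hcast]
        exact ⟨(div_lt_iff₀' hdr).mp hc.1, (lt_div_iff₀' hdr).mp hc.2⟩
      rw [vk13, if_pos hc']
      have hx : (0 : ℝ) < ((d * r * l : ℕ) : ℝ) / P1pp D :=
        div_pos (by rw [hcast]; positivity) hP1
      have hxeq : ((d * r * l : ℕ) : ℝ) / P1pp D = ((d * r : ℕ) : ℝ) / P1pp D * l := by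
        rw [hcast]; ring
      have hconj : conj ((((((d * r * l : ℕ) : ℝ) / P1pp D : ℝ)) : ℂ) ^ (-beta6 D)) =
          ((((d * r * l : ℕ) : ℝ) / P1pp D : ℝ) : ℂ) ^ beta6 D := by
        have harg : ((((d * r * l : ℕ) : ℝ) / P1pp D : ℝ) : ℂ).arg ≠ π := by
          rw [Complex.arg_ofReal_of_nonneg hx.le]; exact Real.pi_pos.ne
        have := Complex.cpow_conj ((((d * r * l : ℕ) : ℝ) / P1pp D : ℝ) : ℂ) (-beta6 D) harg
        rw [Complex.conj_ofReal, map_neg, conj_beta6, neg_neg] at this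
        exact this.symm
      rw [map_mul, map_mul, hconj, Complex.conj_ofReal, Complex.conj_ofReal, hxeq,
        Real.log_mul hA.ne' hl0.ne', Complex.ofReal_mul,
        Complex.mul_cpow_ofReal_nonneg hA.le hl0.le]
      push_cast
      ring
    · rw [if_neg hc]
      have hc' : ¬ (P1pp D < ((d * r * l : ℕ) : ℝ) ∧ ((d * r * l : ℕ) : ℝ) < P2pp D) := by
        rw [hcast]
        intro h
        exact hc ⟨(div_lt_iff₀' hdr).mpr h.1, (lt_div_iff₀' hdr).mpr h.2⟩
      rw [vk13, if_neg hc']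
      simp
  rw [sum122, Finset.sum_congr rfl hterm, ← Finset.sum_filter]
  -- combine the right side into one sum and compare termwise
  rw [Finset.mul_sum, Finset.mul_sum, ← Finset.sum_add_distrib, Finset.mul_sum]
  refine Finset.sum_congr rfl fun l hl => ?_
  have hl1 : 1 ≤ l := (Finset.mem_Ico.mp (Finset.mem_filter.mp hl).1).1
  have hl0 : ((l : ℕ) : ℂ) ≠ 0 := by exact_mod_cast (by omega : l ≠ 0)
  have hlogP : (Real.log (Skeleton.P1 D) : ℂ) ≠ 0 := by
    have hD' : (3 : ℝ) ≤ D := by exact_mod_cast hD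
    have hlog : 0 < ell D := by rw [ell]; exact Real.log_pos (by linarith)
    have hPpos : 0 < bigP D := Real.exp_pos _
    have hlogP1 : Real.log (Skeleton.P1 D) = 0.504 * ell D ^ 9 := by
      rw [Skeleton.P1, Real.log_rpow hPpos, bigP, Real.log_exp]
    rw [hlogP1]
    have : (0 : ℝ) < 0.504 * ell D ^ 9 := by positivity
    exact_mod_cast this.ne'
  simp only [div_eq_mul_inv, inv_natCpow_one_sub hl1]
  push_cast
  field_simp
  ring

/-- For `dr > P″₁` the constraint `P″₁/dr < l` is automatic (`l ≥ 1`) and `l < P″₂/dr` already forces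
`l < ⌈P″₂⌉`: the inner sums of u023 and u029 coincide.
[cite: Zhang2022LandauSiegel, §12 proof of Lemma 12.3, p. 70] -/
theorem innerSumLow_eq_innerSum {D : ℕ} [NeZero D] (hD : 3 ≤ D) (χ : DirichletCharacter ℂ D)
    (j : ℕ) {d r : ℕ} (hd : 1 ≤ d) (hr : 1 ≤ r) (hP1 : P1pp D < ((d * r : ℕ) : ℝ)) :
    innerSumLow c' χ j d r = innerSum c' χ j d r := by
  have hdr1 : 1 ≤ d * r := Nat.one_le_iff_ne_zero.mpr (Nat.mul_ne_zero (by omega) (by omega))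
  have hdr : (0 : ℝ) < ((d * r : ℕ) : ℝ) := by exact_mod_cast lt_of_lt_of_le zero_lt_one hdr1
  have hdr1' : (1 : ℝ) ≤ ((d * r : ℕ) : ℝ) := by exact_mod_cast hdr1
  funext w
  unfold innerSumLow innerSum
  refine Finset.sum_congr ?_ fun _ _ => rfl
  ext l
  simp only [Finset.mem_Ico, Finset.mem_filter, Nat.lt_ceil]
  constructor
  · rintro ⟨h1, h2⟩
    refine ⟨⟨h1, ?_⟩, ?_, h2⟩
    · calc (l : ℝ) < P2pp D / ((d * r : ℕ) : ℝ) := h2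
        _ ≤ P2pp D := div_le_self (P2pp_pos_aux hD).le hdr1'
    · have h3 : P1pp D / ((d * r : ℕ) : ℝ) < 1 := (div_lt_one hdr).mpr hP1
      calc P1pp D / ((d * r : ℕ) : ℝ) < 1 := h3
        _ ≤ (l : ℝ) := by exact_mod_cast h1
  · rintro ⟨⟨h1, _⟩, _, h3⟩
    exact ⟨h1, h3⟩

/-- **Z22:§12.u029 holds** — "The left side is equal to
`−(1/log P₁)∂_w((dr/P″₁)^{β₆−w}Σ_{l<P″₂/dr} χ(l)ξ_j(l;d,r)/l^{1−β₆+w})|_{w=0}`" for `P″₁ < dr < P₂`: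
by u023 and the coincidence of the two index sets. Kernel-checked; the node is DISCHARGED.
[cite: Zhang2022LandauSiegel, §12 proof of Lemma 12.3, p. 70] -/
theorem U029_holds : U029 c' := by
  obtain ⟨D₀, h⟩ := U023_holds c'
  refine ⟨max D₀ 3, fun D _ χ hD hq hp j hj d r hd hr hP1 _ => ?_⟩
  have hD3 : 3 ≤ D := le_trans (le_max_right _ _) hD
  have key := h D χ (le_trans (le_max_left _ _) hD) hq hp j hj d r hd hr
  have hb : bracket123 c' χ j d r = bracket122 c' χ j d r := by
    funext w
    rw [bracket123, bracket122, innerSumLow_eq_innerSum c' hD3 χ j hd hr hP1]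
  rw [key, hb]

/-! ### The exact size of `ϰ₁₃` below `P″₁T` (for the constants-flow audit of Lemma 12.1's remark) -/

/-- **The size of `ϰ₁₃` below `P″₁T`, exactly** (cf. `Rem121vk13`, the printed "`ϰ₁₃(n) ≪ α₁` if
`P″₁/T ≤ n ≤ P″₁T`"): for `n ≤ P″₁T`, `|ϰ₁₃(n)| ≤ log T/log P₁` (`= 𝓛^{1.1}/(0.504𝓛⁹)`; `ϰ₁₃(n) = 0`
for `n ≤ P″₁`, and `|ϰ₁₃(n)| = log(n/P″₁)/log P₁` on its window since `|(n/P″₁)^{−β₆}| = 1`). PROVED;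
it neither asserts nor refutes the `α₁`-form of the remark (`α₁` is undefined in v1).
[cite: Zhang2022LandauSiegel, §12 proof of Lemma 12.1, p. 68] -/
theorem vk13_norm_le : ForAllLarge fun D _ _ => ∀ n : ℕ, (n : ℝ) ≤ P1pp D * bigT D →
    ‖vk13 D n‖ ≤ Real.log (bigT D) / Real.log (Skeleton.P1 D) := by
  refine ⟨3, fun D _ χ hD _ _ n hn => ?_⟩
  have hP1pp : 0 < P1pp D := P1pp_pos hD
  have hD' : (3 : ℝ) ≤ D := by exact_mod_cast hD
  have hlog : 0 < ell D := by rw [ell]; exact Real.log_pos (by linarith)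
  have hPpos : 0 < bigP D := Real.exp_pos _
  have hlogP1 : 0 < Real.log (Skeleton.P1 D) := by
    have : Real.log (Skeleton.P1 D) = 0.504 * ell D ^ 9 := by
      rw [Skeleton.P1, Real.log_rpow hPpos, bigP, Real.log_exp]
    rw [this]; positivity
  have hlogT : 0 ≤ Real.log (bigT D) := by
    rw [bigT, Real.log_exp]; positivity
  by_cases hc : P1pp D < n ∧ (n : ℝ) < P2pp D
  · rw [vk13, if_pos hc]
    have hn0 : (0 : ℝ) < n := lt_trans hP1pp hc.1
    have hx : 0 < (n : ℝ) / P1pp D := div_pos hn0 hP1pp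
    rw [norm_mul, norm_mul, Complex.norm_real, Complex.norm_real,
      Complex.norm_cpow_eq_rpow_re_of_pos hx]
    have hre : (-beta6 D).re = 0 := by simp [beta6]
    rw [hre, Real.rpow_zero, mul_one]
    have h1 : 1 ≤ (n : ℝ) / P1pp D := ((one_le_div hP1pp).mpr hc.1.le)
    have hlogx : 0 ≤ Real.log ((n : ℝ) / P1pp D) := Real.log_nonneg h1
    have hxT : (n : ℝ) / P1pp D ≤ bigT D := by
      rw [div_le_iff₀ hP1pp, mul_comm]; exact hn
    have hlogx' : Real.log ((n : ℝ) / P1pp D) ≤ Real.log (bigT D) := Real.log_le_log hx hxT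
    rw [Real.norm_eq_abs, Real.norm_eq_abs, abs_of_pos (inv_pos.mpr hlogP1), abs_of_nonneg hlogx,
      inv_mul_eq_div]
    exact div_le_div_of_nonneg_right hlogx' hlogP1.le
  · rw [vk13, if_neg hc, norm_zero]
    positivity

end Discharges

/-! ## The assembly of (12.10) from the displayed steps of its proof

"Gathering these results together we obtain (12.10)" (p. 70): with u023 and u027 PROVED above, the
printed (12.10) — in the `O(𝓛⁻¹⁵)` reading `Eq1210L15` — follows from the single remaining analytic
node `U026read` (the Cauchy-formula step with its factor), the identity `log P₁ = 0.504·log P`, and the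
definition of `b*`; the main term comes out EXACTLY as printed. -/

section AssemblyTwelveTen

variable (c' : ℝ)

/-- `log P₁ = 0.504·log P` (`P₁ = P^{0.504}`, (2.21)). [cite: Zhang2022LandauSiegel, §2 (2.21)] -/
private theorem log_P1_eq_bigP (D : ℕ) : Real.log (Skeleton.P1 D) = 0.504 * Real.log (bigP D) := by
  have hP : 0 < bigP D := Real.exp_pos _
  rw [Skeleton.P1, Real.log_rpow hP]

/-- **(12.10), `O(𝓛⁻¹⁵)` reading, from the one analytic step `U026read`** ("Gathering these results
together we obtain (12.10)", p. 70): `U026read c′ → Eq1210L15 c′`. The displayed identities u023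
(`U023_holds`) and u027 (`U027_holds`) are used as theorems; `−(1/log P₁)·[L′Πβ_{j+1}β_{j+2}·
(−(log P)²∫₀^{0.004}ze^{3πiz/2}dz)] = b*L′(1,χ)Π(d,r)(log P)β_{j+1}β_{j+2}` exactly since
`log P₁ = 0.504 log P`, and the `O(𝓛⁻⁶)` of `U026read` becomes `O(𝓛⁻⁶)/(0.504𝓛⁹) = O(𝓛⁻¹⁵)`.
Kernel-checked EDGE. [cite: Zhang2022LandauSiegel, §12 proof of Lemma 12.2, p. 70] -/
theorem eq1210L15_of_u026read (h26 : U026read c') : Eq1210L15 c' := by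
  obtain ⟨C₁, D₁, h₁⟩ := h26
  obtain ⟨D₂, h₂⟩ := U023_holds c'
  obtain ⟨D₃, h₃⟩ := U027_holds
  refine ⟨|C₁| / 0.504, max (max D₁ D₂) (max D₃ 3),
    fun D _ χ hD hq hp hA j hj d r hd hr hdr => ?_⟩
  have hD1 : D₁ ≤ D := le_trans (le_trans (le_max_left _ _) (le_max_left _ _)) hD
  have hD2 : D₂ ≤ D := le_trans (le_trans (le_max_right _ _) (le_max_left _ _)) hD
  have hD3 : D₃ ≤ D := le_trans (le_trans (le_max_left _ _) (le_max_right _ _)) hD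
  have hD3' : 3 ≤ D := le_trans (le_trans (le_max_right _ _) (le_max_right _ _)) hD
  have e23 : sum122 c' χ j d r =
      -(1 / (Real.log (Skeleton.P1 D) : ℂ)) * deriv (bracket122 c' χ j d r) 0 :=
    h₂ D χ hD2 hq hp j hj d r hd hr
  have e26 := h₁ D χ hD1 hq hp hA j hj d r hd hr hdr.le
  have e27 : deriv (modelInt026 D) 0 =
      -((Real.log (bigP D) : ℂ) ^ 2) * ∫ z in (0 : ℝ)..0.004, (z : ℂ) * cexp (3 * π * I * z / 2) :=
    h₃ D χ hD3 hq hp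
  -- the parameters
  have hD' : (3 : ℝ) ≤ D := by exact_mod_cast hD3'
  have hlog : 0 < ell D := by rw [ell]; exact Real.log_pos (by linarith)
  have hLpv : Real.log (bigP D) = ell D ^ 9 := by rw [bigP, Real.log_exp]
  have hLp : ((Real.log (bigP D) : ℝ) : ℂ) ≠ 0 := by
    rw [hLpv]; exact_mod_cast (pow_pos hlog 9).ne'
  have h504 : ((0.504 : ℝ) : ℂ) ≠ 0 := by exact_mod_cast (by norm_num : (0.504 : ℝ) ≠ 0)
  have hL1 : (Real.log (Skeleton.P1 D) : ℂ) = ((0.504 : ℝ) : ℂ) * (Real.log (bigP D) : ℂ) := by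
    rw [log_P1_eq_bigP, Complex.ofReal_mul]
  -- the remainder of the Cauchy step
  set Δ : ℂ := deriv (bracket122 c' χ j d r) 0 -
    deriv χ.LFunction 1 * PiW χ d r * betaJ c' D (j + 1) * betaJ c' D (j + 2) *
      deriv (modelInt026 D) 0 with hΔ
  have hbr : deriv (bracket122 c' χ j d r) 0 =
      Δ + deriv χ.LFunction 1 * PiW χ d r * betaJ c' D (j + 1) * betaJ c' D (j + 2) *
        deriv (modelInt026 D) 0 := by
    rw [hΔ]; ring
  have hb : bstar = ((1 / 0.504 : ℝ) : ℂ) *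
      ∫ z in (0 : ℝ)..0.004, (z : ℂ) * cexp (3 * π * I * z / 2) := bstar_eq_display
  have key : sum122 c' χ j d r - main1210 c' χ j d r =
      -(1 / (((0.504 : ℝ) : ℂ) * (Real.log (bigP D) : ℂ))) * Δ := by
    rw [e23, hL1, main1210, hb, hbr, e27]
    generalize (∫ z in (0 : ℝ)..0.004, (z : ℂ) * cexp (3 * π * I * z / 2)) = K
    push_cast
    field_simp
    ring
  rw [key]
  have hden : (0 : ℝ) < 0.504 * ell D ^ 9 := by positivity
  have hnorm : ‖-(1 / (((0.504 : ℝ) : ℂ) * (Real.log (bigP D) : ℂ))) * Δ‖ =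
      ‖Δ‖ / (0.504 * ell D ^ 9) := by
    rw [norm_mul, norm_neg, ← Complex.ofReal_mul, norm_div, norm_one, Complex.norm_real, hLpv,
      Real.norm_eq_abs, abs_of_pos hden]
    ring
  rw [hnorm]
  have hℓ6 : (0 : ℝ) < ell D ^ 6 := pow_pos hlog 6
  calc ‖Δ‖ / (0.504 * ell D ^ 9) ≤ C₁ * (ell D ^ 6)⁻¹ / (0.504 * ell D ^ 9) := by
        gcongr
    _ = C₁ / 0.504 * (ell D ^ 15)⁻¹ := by
        field_simp
    _ ≤ |C₁| / 0.504 * (ell D ^ 15)⁻¹ := by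
        gcongr
        exact le_abs_self C₁

/-- **Lemma 12.2, `O(𝓛⁻¹⁵)` reading, modulo `U026read` and the unproved-in-print (12.11)**:
`U026read c′ → Eq1211 c′ → Lemma122 c′ 𝓛⁻¹⁵`. [cite: Zhang2022LandauSiegel, §12 Lemma 12.2, pp. 69–70] -/
theorem lemma122L15_of (h26 : U026read c') (h1211 : Eq1211 c') :
    Lemma122 c' (fun D => (ell D ^ 15)⁻¹) :=
  ⟨eq1210L15_of_u026read c' h26, h1211⟩

end AssemblyTwelveTen

end Literature.NumberTheory.LFunctions.Zhang2022.Typed.Sec12B
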